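import Literature.NumberTheory.Sieve.FriedlanderIwaniecPrimesSectorBounds
import Literature.NumberTheory.Sieve.FriedlanderIwaniecPrimesBilinearReduction
import Literature.NumberTheory.Sieve.FriedlanderIwaniecPrimesRough
import Literature.NumberTheory.Sieve.AsymptoticSieveForPrimesTheorem3
import Literature.NumberTheory.Sieve.FriedlanderIwaniecPrimesLemma31Holds
import HarnessLib

/-!
# Friedlander–Iwaniec, *The polynomial `X² + Y⁴` captures its primes*, §5 PROVED: (4.23) from (5.15)

Family `parity`, statement parity.S17 (`setOf_prime_sq_add_pow_four_infinite`). Source: J. Friedlander,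
H. Iwaniec, Ann. of Math. (2) 148 (1998), 945–1040 [FriedlanderIwaniecAnnals1998], §5 "The bilinear
form in the sieve: Transformations", (5.1)–(5.16), with §4 (4.11)–(4.23) and the parameter choices
of §18: "Since the number of polar boxes is `O(θ⁻²)` we now need to prove that for the bilinear form
`B(M, N)` restricted smoothly to a box we have (5.15) `B(M, N) ≪ ϑθ²(MN)^{3/4}(log MN)⁴` … We can
assume that `|φ (mod π/2)| > πϑ` because the other sectors, altogether of angle `≤ 2πϑ`, contribute
no more than the bound (4.23) by the estimate (5.16)"; (5.10)–(5.11) "the error term in (5.10) is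
admissible for (4.23) if `N ≤ ϑθ√(MN)` and `ϑθP ≥ 1`. The first condition is satisfied if (5.11)
`B ≥ 3A/2 + A'` … The second condition requires `P ≥ (log x)^{A+A'}`".

**Main result.** `FriedlanderIwaniec1998_bilinBound_of_sectorBound`: the bound (4.23) for the forms
`B*(M, N)` — in the shape `BilinBoundAt` of `…BilinearReduction`, i.e. the hypothesis of
`FriedlanderIwaniec1998_prop41_of_bilinear423` — for POSITIVE `P` in (4.4), follows from the sector
bound (5.15) — in the parallel shape `Sector515At` of this file — for positive `P`. Everything of §5
up to (5.16) is PROVED here and in `…SectorBounds`; (5.15)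
itself (§§5–26 of the source: Lemma 5.1, §§6–9, Prop. 10.2, Props. 11.1–17.3, §18) is the
hypothesis. Part 2 of this file carries the restriction `0 < P` up to Theorem 1.

**Why `0 < P`.** The tree's (4.4)-condition `(log log x)² ≤ log P ≤ (log x)(log log x)⁻²` is stated
with `Real.log`, so it admits negative `P` (`Real.log P = Real.log |P|`), for which (4.21)
`(n, Π) = 1` is vacuous and `B*(M, N)` has even `n` in its support; (5.2)–(5.6) (primary `z`, odd
norms) and (5.10) (`p ≥ P > 2`) need `P > 2`, which (4.4) gives exactly when `P > 0`. The source's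
`P` is a sieving range of primes.

**Parameters** (see the docstring of `…BilinearReduction` for `A₂ = 2A + 8` versus the printed
(4.19)). Given the (5.15)-data `A', t, B, K` for `η, A`, (4.23) holds with the same `A', t`, with
`B' = max(B, 2t + A + A' + A₂/2 + 1)` ("If we take `B` sufficiently large we then ensure the
remaining conditions (5.11)": here `M ≥ N`, `125τ²N ≤ ϑθ√(MN)`; the `P`-condition
`P ≥ 1450τ²(ϑθ)⁻¹` and `175τ² ≤ ϑθ(MN)^{1/4}` hold for large `x` by (4.4), (4.19)), and
`K' = 384M_ψK + 210003` (`M_ψ` = the bound for `ψ', ψ''` of `Real.smoothTransition` normalising the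
angular partition; `384 = 3 · 64 · 2`: `≤ 3/θ` arcs, `64` classes, `2M_ψ`; `210000 ≥ 22050 · 3π`
from the near-axis count; `3` from (5.10)).

## Contents (namespace `FriedlanderIwaniecPrimes`)

* numerics: `fiSector_floor_facts`, `fiSector_W_facts`, `fiSector_D_facts`, `fiSector_T0_le`,
  `fiSector_ratio_le`, `fiSector_InB_le`, `fiSector_rpow_quarter_mul`, `fiSector_nearAxis_total_le`
  (near-axis total `≤ 22050 ϖθ(MN)^{3/4}(log MN)⁴`, `ϖ = πϑ + 2πθ`), `fiSector_compl_total_le`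
  ((5.10) total `≤ 3ϑθ(MN)^{3/4}(log MN)⁴` under the admissibility conditions);
* **`norm_fiBilinearStar_le_at`** — `‖B*(M, N)‖ ≤ (384M_ψK + 210003) ϑθ(MN)^{3/4}(log MN)⁴` at fixed
  outer data from `SectorBoundAt` and the side conditions;
* `bilinBoundAt_of_sector515At` (pointwise in `x, P, N, C`; `Sector515At` is the hypothesis shape of
  `…SectorBounds`, the §5 twin of `BilinBoundAt`);
* `P_conditions`, `N_conditions`, `M_conditions` — the side conditions along (4.4), (4.6), (4.19);
* **`FriedlanderIwaniec1998_bilinBound_of_sectorBound`** — the quantified form.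

## References

* J. Friedlander, H. Iwaniec, Ann. of Math. (2) 148 (1998), 945–1040: §5 (5.1)–(5.16); §4
  (4.4)–(4.6), (4.11)–(4.23); §18. [FriedlanderIwaniecAnnals1998]

## Tree

`BilinBoundAt`, `eventually_mul_log_rpow_le`, `eventually_mul_log_rpow_le_rpow`
(`…BilinearReduction`), `exists_bound_deriv_smoothTransition` (`…BilinearPartition`), `angCount_le`
(`…AngularPartition`), `exists_abs_sub_mul_pi_div_two_le`, `abs_re_le_or_abs_im_le_of_arg`
and the bounds of `…SectorBounds`.

## Part 2 of this file: the chain for positive `P`, and Theorem 1 from (5.15)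


Family `parity`, statement parity.S17 (`setOf_prime_sq_add_pow_four_infinite`). Source: J. Friedlander,
H. Iwaniec, Ann. of Math. (2) 148 (1998), 945–1040 [FriedlanderIwaniecAnnals1998], §§2–5: Theorem 1
via Proposition 2.1 ((2.11) = (B*)), Proposition 3.5, Proposition 4.1 (4.4)–(4.6), (4.23), (5.15).

**Why Part 2.** The tree's statements of Proposition 4.1 (`FriedlanderIwaniec1998_prop41`) and of
(4.23) (`FriedlanderIwaniecPrimes.BilinBoundAt`, the hypothesis of
`FriedlanderIwaniec1998_prop41_of_bilinear423`) quantify over all real `P` with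
(4.4) `(log log x)² ≤ log P ≤ (log x)(log log x)⁻²`. Since `Real.log P = Real.log |P|`, this range
contains negative `P`, for which the sieving condition (4.21) `(n, Π) = 1` is vacuous; the source's
`P` is a sieving range of primes (positive), and the §5 reduction of (4.23) to (5.15)
(`FriedlanderIwaniecPrimes.FriedlanderIwaniec1998_bilinBound_of_sectorBound`,
Part 1) needs `P > 2` ((5.2)–(5.6): `n` odd). Part 2 therefore re-runs the short
top of the tree's deduction of Theorem 1 with `0 < P` added to the hypothesis on `P` — the only
value ever used being `P = exp((log log x)²)` (`fiP`) — and composes it with the §5 reduction: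

* `FriedlanderIwaniec1998_prop41pos_of_bilinBound` — Proposition 4.1 for positive `P` from (4.23)
  for positive `P` (the proof of `FriedlanderIwaniec1998_prop41_of_bilinear423`, §4, verbatim with
  `0 < P` threaded through);
* `FriedlanderIwaniecPrimesSquarefree.hyp211_sq_pos`, `sieveHypotheses_sq_pos`,
  `primeSum_asymp_of_rough_inputs_pos` — (2.11) and (2.1)–(2.15) for `a' = μ² a`, and (4.7)–(4.8),
  from Proposition 4.1 for positive `P` (the proofs of `hyp211_sq`, `sieveHypotheses_sq`,
  `primeSum_asymp_of_rough_inputs` verbatim; they use Proposition 4.1 at `P = fiP x > 0` only);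
* `FriedlanderIwaniec1998_primeSum_asymp_of_prop41pos`, `friedlanderIwaniecSum_isEquivalent_of_prop41pos`,
  `setOf_prime_sq_add_pow_four_infinite_of_prop41pos` — Theorem 1 from Proposition 4.1 for
  positive `P` alone (Lemma 3.1, Proposition 3.5, ASP Theorem 1 with (B*), (2.7) being proved in the
  tree);
* **`FriedlanderIwaniec1998_primeSum_asymp_of_sectorBound`,
  `friedlanderIwaniecSum_isEquivalent_of_sectorBound`,
  `setOf_prime_sq_add_pow_four_infinite_of_sectorBound`** — Theorem 1 (parity.S17, (4.7)–(4.8),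
  infinitely many primes `a² + b⁴`) from the sector bound (5.15) alone: the trust base of
  parity.S17 becomes FI (5.15) for the sector forms `B(M, N)` off the axes (proved in §§5–26 of
  the source).

## References

* J. Friedlander, H. Iwaniec, Ann. of Math. (2) 148 (1998), 945–1040: Theorem 1, Proposition 2.1,
  Proposition 3.5, Proposition 4.1 with (4.4)–(4.6), (4.23), (5.15). [FriedlanderIwaniecAnnals1998]
* J. Friedlander, H. Iwaniec, Ann. of Math. (2) 148 (1998), 1041–1065, Theorems 1–3.
  [FriedlanderIwaniecASP1998]

## Tree

`fiBilinearPi_le_at`, `BilinBoundAt`, `eventually_*` (`…BilinearReduction`); `hyp21_sq` …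
`hyp29_sq`, `ranges_sq`, `fiBilinearPi_sq_le`, `fiCountSq_bounds`, `levelSq_and_countSq`
(`…SquarefreeProofs`); `prop21_squarefree_of_rough_loglog`, `setOf_prime_sq_add_pow_four_infinite_of_primeSum`
(`…Rough`, `…Infinitude`); `fi_asymptotic_sieve_primes_rough_loglog_holds` (`AsymptoticSieveForPrimesTheorem3`);
`FriedlanderIwaniec1998_prop35_holds`, `FriedlanderIwaniec1998_hyp27_holds` (`…Lemma31Holds`,
`…Hyp27Unconditional`); `Sector515At` (`…SectorBounds`).
-/

noncomputable section

open Finset Real Filter Asymptotics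
open scoped ArithmeticFunction.sigma ArithmeticFunction.Moebius ArithmeticFunction.omega
open Literature.NumberTheory.QuadraticFields.GaussianPrimary

namespace Literature.NumberTheory.Sieve.FriedlanderIwaniecPrimes

/-! ### Numerical bookkeeping: the floors `Y₁ = ⌊N'⌋`, `Y₂ = ⌊(1+θ)N'⌋`, `X₂ = ⌊2M⌋` -/

/-- The two ends of the `n`-segment: `1 ≤ Y₁ ≤ Y₂`, `N/2 < Y₁ ≤ 2N`, `Y₂ ≤ 3N`, `Y₂ - Y₁ ≤ 3θN`.
[folklore] -/
theorem fiSector_floor_facts {N N' θ : ℝ} (hN2 : 2 ≤ N) (hNN' : N < N') (hN'2 : N' < 2 * N) (hθ : 0 < θ)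
    (hθ1 : θ ≤ 1 / 2) (hθN : 1 ≤ θ * N) :
    0 < ⌊N'⌋₊ ∧ ⌊N'⌋₊ ≤ ⌊(1 + θ) * N'⌋₊ ∧ N / 2 < (⌊N'⌋₊ : ℝ) ∧ (⌊N'⌋₊ : ℝ) ≤ 2 * N ∧
      (⌊(1 + θ) * N'⌋₊ : ℝ) ≤ 3 * N ∧ 1 ≤ (⌊(1 + θ) * N'⌋₊ : ℝ) ∧
      (⌊(1 + θ) * N'⌋₊ : ℝ) - ⌊N'⌋₊ ≤ 3 * θ * N := by
  have hN'0 : 0 ≤ N' := by linarith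
  have h1 : 0 < ⌊N'⌋₊ := Nat.floor_pos.mpr (by linarith)
  have h2 : ⌊N'⌋₊ ≤ ⌊(1 + θ) * N'⌋₊ := Nat.floor_mono (by nlinarith)
  have hY₁le : (⌊N'⌋₊ : ℝ) ≤ N' := Nat.floor_le hN'0
  have hY₁gt : N' < (⌊N'⌋₊ : ℝ) + 1 := Nat.lt_floor_add_one N'
  have hY₂le : (⌊(1 + θ) * N'⌋₊ : ℝ) ≤ (1 + θ) * N' := Nat.floor_le (by positivity)
  have h2' : ((⌊N'⌋₊ : ℕ) : ℝ) ≤ ⌊(1 + θ) * N'⌋₊ := by exact_mod_cast h2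
  have h1' : (1 : ℝ) ≤ ⌊N'⌋₊ := by exact_mod_cast h1
  refine ⟨h1, h2, by linarith, by linarith, by nlinarith, by linarith, by nlinarith⟩

/-- The near-axis width `W = ⌊ϖ√Y₂⌋`: `2W² ≤ Y₁` and `2W + 1 ≤ 5ϖ√N`. [folklore] -/
theorem fiSector_W_facts {N ϖ : ℝ} {Y₁ Y₂ : ℕ} (hN : 0 < N) (hY₁ : N / 2 < Y₁) (hY₂ : (Y₂ : ℝ) ≤ 3 * N)
    (hϖ0 : 0 < ϖ) (hϖ : ϖ ≤ 1 / 4) (hϖN : 1 ≤ ϖ * Real.sqrt N) :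
    2 * ⌊ϖ * Real.sqrt Y₂⌋₊ ^ 2 ≤ Y₁ ∧ (2 * (⌊ϖ * Real.sqrt Y₂⌋₊ : ℝ) + 1) ≤ 5 * ϖ * Real.sqrt N := by
  set W := ⌊ϖ * Real.sqrt Y₂⌋₊ with hW
  have hsN : 0 < Real.sqrt N := Real.sqrt_pos.mpr hN
  have hW0 : (W : ℝ) ≤ ϖ * Real.sqrt Y₂ := Nat.floor_le (by positivity)
  have hY₂s : Real.sqrt Y₂ ≤ 2 * Real.sqrt N := by
    calc Real.sqrt Y₂ ≤ Real.sqrt (4 * N) := Real.sqrt_le_sqrt (by linarith)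
      _ = 2 * Real.sqrt N := by
          rw [Real.sqrt_mul (by norm_num), show (4 : ℝ) = 2 ^ 2 by norm_num, Real.sqrt_sq (by norm_num)]
  have hW1 : (W : ℝ) ≤ 2 * ϖ * Real.sqrt N := by nlinarith
  constructor
  · have hsq : (W : ℝ) ^ 2 ≤ ϖ ^ 2 * Y₂ := by
      have h0 : (0 : ℝ) ≤ W := Nat.cast_nonneg _
      calc (W : ℝ) ^ 2 ≤ (ϖ * Real.sqrt Y₂) ^ 2 := pow_le_pow_left₀ h0 hW0 2
        _ = ϖ ^ 2 * Y₂ := by rw [mul_pow, Real.sq_sqrt (Nat.cast_nonneg _)]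
    have hϖ2 : ϖ ^ 2 ≤ 1 / 16 := by nlinarith
    have : 2 * (W : ℝ) ^ 2 ≤ Y₁ := by nlinarith
    exact_mod_cast this
  · nlinarith

/-- `(Y₂)^{1/3}`-facts for `D = ⌊Y₂^{1/3}⌋`: every `d` with `d³ ≤ Y₂` is `≤ D`; `5D ≤ θ√N`;
`0 ≤ 1 + log D ≤ log MN`. [folklore] -/
theorem fiSector_D_facts {N θ M : ℝ} {Y₂ : ℕ} (hN1 : 1 ≤ N) (hY₂1 : 1 ≤ (Y₂ : ℝ)) (hY₂ : (Y₂ : ℝ) ≤ 3 * N)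
    (hDθ : 5 * (3 * N) ^ (1 / 3 : ℝ) ≤ θ * Real.sqrt N)
    (hlog : 2 + (Real.log 3 + Real.log N) / 3 ≤ Real.log (M * N)) :
    (∀ d : ℕ, 0 < d → d ^ 3 ≤ Y₂ → d ≤ ⌊(Y₂ : ℝ) ^ (1 / 3 : ℝ)⌋₊) ∧
      5 * (⌊(Y₂ : ℝ) ^ (1 / 3 : ℝ)⌋₊ : ℝ) ≤ θ * Real.sqrt N ∧
      0 ≤ 1 + Real.log ⌊(Y₂ : ℝ) ^ (1 / 3 : ℝ)⌋₊ ∧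
      1 + Real.log ⌊(Y₂ : ℝ) ^ (1 / 3 : ℝ)⌋₊ ≤ Real.log (M * N) := by
  set D := ⌊(Y₂ : ℝ) ^ (1 / 3 : ℝ)⌋₊ with hD
  have hY₂0 : (0 : ℝ) < Y₂ := by linarith
  have hN0 : 0 < N := by linarith
  have hDle : (D : ℝ) ≤ (Y₂ : ℝ) ^ (1 / 3 : ℝ) := Nat.floor_le (by positivity)
  have hD3N : (Y₂ : ℝ) ^ (1 / 3 : ℝ) ≤ (3 * N) ^ (1 / 3 : ℝ) :=
    Real.rpow_le_rpow (by positivity) hY₂ (by norm_num)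
  have hlog3 : Real.log 3 ≤ 2 := by
    have := Real.log_le_sub_one_of_pos (by norm_num : (0 : ℝ) < 3); linarith
  have hlogN : 0 ≤ Real.log N := Real.log_nonneg (by linarith)
  refine ⟨?_, ?_, ?_, ?_⟩
  · intro d hd hd3
    refine Nat.le_floor ?_
    have hd3r : ((d : ℝ)) ^ (3 : ℕ) ≤ (Y₂ : ℝ) := by exact_mod_cast hd3
    calc (d : ℝ) = (((d : ℝ)) ^ (3 : ℕ)) ^ ((3 : ℕ) : ℝ)⁻¹ :=
          (Real.pow_rpow_inv_natCast (Nat.cast_nonneg _) (by norm_num)).symm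
      _ ≤ (Y₂ : ℝ) ^ ((3 : ℕ) : ℝ)⁻¹ := Real.rpow_le_rpow (by positivity) hd3r (by positivity)
      _ = (Y₂ : ℝ) ^ (1 / 3 : ℝ) := by norm_num
  · linarith
  · rcases Nat.eq_zero_or_pos D with h0 | hpos
    · rw [h0]; simp
    · have : (1 : ℝ) ≤ D := by exact_mod_cast hpos
      linarith [Real.log_nonneg this]
  · rcases Nat.eq_zero_or_pos D with h0 | hpos
    · rw [h0]; simp; linarith [Real.log_nonneg (show (1:ℝ) ≤ 3 by norm_num)]
    · have hD1 : (1 : ℝ) ≤ D := by exact_mod_cast hpos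
      have hlogD : Real.log D ≤ (Real.log 3 + Real.log N) / 3 := by
        calc Real.log D ≤ Real.log ((Y₂ : ℝ) ^ (1 / 3 : ℝ)) := Real.log_le_log (by linarith) hDle
          _ = (1 / 3) * Real.log Y₂ := Real.log_rpow hY₂0 _
          _ ≤ (1 / 3) * Real.log (3 * N) := by
              gcongr
          _ = (Real.log 3 + Real.log N) / 3 := by rw [Real.log_mul (by norm_num) hN0.ne']; ring
      linarith

/-- `16^{1/4} = 2`. [folklore] -/
theorem fiSector_rpow_sixteen_quarter : (16 : ℝ) ^ (1 / 4 : ℝ) = 2 := by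
  rw [show (16 : ℝ) = 2 ^ (4 : ℕ) by norm_num, show (1 / 4 : ℝ) = ((4 : ℕ) : ℝ)⁻¹ by norm_num]
  exact Real.pow_rpow_inv_natCast (by norm_num) (by norm_num)

/-- `T₀ = (X₂Y₂)^{1/4} ≤ 2(MN)^{1/4}` for `X₂ ≤ 2M`, `Y₂ ≤ 3N`. [folklore] -/
theorem fiSector_T0_le {M N : ℝ} {X₂ Y₂ : ℕ} (hN : 0 ≤ N) (hM : 0 ≤ M) (hX₂ : (X₂ : ℝ) ≤ 2 * M)
    (hY₂ : (Y₂ : ℝ) ≤ 3 * N) :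
    ((X₂ : ℝ) * Y₂) ^ (1 / 4 : ℝ) ≤ 2 * (M * N) ^ (1 / 4 : ℝ) := by
  have h1 : (X₂ : ℝ) * Y₂ ≤ 16 * (M * N) := by
    have hX0 : (0 : ℝ) ≤ X₂ := Nat.cast_nonneg _
    have hY0 : (0 : ℝ) ≤ Y₂ := Nat.cast_nonneg _
    calc (X₂ : ℝ) * Y₂ ≤ (2 * M) * (3 * N) := mul_le_mul hX₂ hY₂ hY0 (by linarith)
      _ ≤ 16 * (M * N) := by nlinarith
  calc ((X₂ : ℝ) * Y₂) ^ (1 / 4 : ℝ) ≤ (16 * (M * N)) ^ (1 / 4 : ℝ) :=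
        Real.rpow_le_rpow (by positivity) h1 (by norm_num)
    _ = 2 * (M * N) ^ (1 / 4 : ℝ) := by
        rw [Real.mul_rpow (by norm_num) (by positivity), fiSector_rpow_sixteen_quarter]

/-- `2√X₂/√(Y₁/2) ≤ 6√M/√N` for `X₂ ≤ 2M`, `N/2 < Y₁`, `N > 0`. [folklore] -/
theorem fiSector_ratio_le {M N : ℝ} {X₂ Y₁ : ℕ} (hN : 0 < N) (hX₂ : (X₂ : ℝ) ≤ 2 * M)
    (hY₁ : N / 2 < Y₁) :
    2 * Real.sqrt X₂ / Real.sqrt (Y₁ / 2) ≤ 6 * (Real.sqrt M / Real.sqrt N) := by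
  have hsN : 0 < Real.sqrt N := Real.sqrt_pos.mpr hN
  have hs2 : Real.sqrt 2 ≤ 3 / 2 := by
    rw [show (3 / 2 : ℝ) = Real.sqrt ((3 / 2) ^ 2) by rw [Real.sqrt_sq (by norm_num)]]
    exact Real.sqrt_le_sqrt (by norm_num)
  have hX : Real.sqrt X₂ ≤ 3 / 2 * Real.sqrt M := by
    calc Real.sqrt X₂ ≤ Real.sqrt (2 * M) := Real.sqrt_le_sqrt hX₂
      _ = Real.sqrt 2 * Real.sqrt M := Real.sqrt_mul (by norm_num) M
      _ ≤ 3 / 2 * Real.sqrt M := mul_le_mul_of_nonneg_right hs2 (Real.sqrt_nonneg _)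
  have hY : Real.sqrt N / 2 ≤ Real.sqrt (Y₁ / 2) := by
    calc Real.sqrt N / 2 = Real.sqrt (N / 4) := by
          rw [Real.sqrt_div' N (by norm_num : (0:ℝ) ≤ 4), show (4 : ℝ) = 2 ^ 2 by norm_num,
            Real.sqrt_sq (by norm_num)]
      _ ≤ Real.sqrt (Y₁ / 2) := Real.sqrt_le_sqrt (by linarith)
  have hq0 : 0 < Real.sqrt N / 2 := by positivity
  have h1 : 2 * Real.sqrt X₂ / Real.sqrt (Y₁ / 2) ≤ 2 * (3 / 2 * Real.sqrt M) / (Real.sqrt N / 2) :=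
    div_le_div₀ (by positivity) (by linarith) hq0 hY
  have h2 : 2 * (3 / 2 * Real.sqrt M) / (Real.sqrt N / 2) = 6 * (Real.sqrt M / Real.sqrt N) := by
    field_simp; ring
  linarith

/-- The inner `w`-count in terms of `M, N`: for `M ≥ N ≥ 1`, `X₂ ≤ 2M`, `N/2 < Y₁`, `Y₂ ≤ 3N`,
`(2(X₂Y₂)^{1/4} + 1)(2√X₂/√(Y₁/2) + 1) ≤ 35 (MN)^{1/4} √M/√N` ("`≪ M^{3/4}N^{-1/4}`"). [folklore] -/
theorem fiSector_InB_le {M N : ℝ} {X₂ Y₁ Y₂ : ℕ} (hN : 1 ≤ N) (hMN : N ≤ M) (hX₂ : (X₂ : ℝ) ≤ 2 * M)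
    (hY₁ : N / 2 < Y₁) (hY₂ : (Y₂ : ℝ) ≤ 3 * N) :
    (2 * ((X₂ : ℝ) * Y₂) ^ (1 / 4 : ℝ) + 1) * (2 * Real.sqrt X₂ / Real.sqrt (Y₁ / 2) + 1) ≤
      35 * (M * N) ^ (1 / 4 : ℝ) * (Real.sqrt M / Real.sqrt N) := by
  have hN0 : 0 < N := by linarith
  have hM : 0 < M := hN0.trans_le hMN
  have hsN : 0 < Real.sqrt N := Real.sqrt_pos.mpr hN0
  have ha1 : 1 ≤ (M * N) ^ (1 / 4 : ℝ) := Real.one_le_rpow (by nlinarith) (by norm_num)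
  have hρ1 : 1 ≤ Real.sqrt M / Real.sqrt N := by
    rw [le_div_iff₀ hsN, one_mul]; exact Real.sqrt_le_sqrt hMN
  have hf1 : 2 * ((X₂ : ℝ) * Y₂) ^ (1 / 4 : ℝ) + 1 ≤ 5 * (M * N) ^ (1 / 4 : ℝ) := by
    have := fiSector_T0_le hN0.le hM.le hX₂ hY₂; linarith
  have hf2 : 2 * Real.sqrt X₂ / Real.sqrt (Y₁ / 2) + 1 ≤ 7 * (Real.sqrt M / Real.sqrt N) := by
    have := fiSector_ratio_le hN0 hX₂ hY₁; linarith
  have hf20 : 0 ≤ 2 * Real.sqrt X₂ / Real.sqrt (Y₁ / 2) + 1 := by positivity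
  calc (2 * ((X₂ : ℝ) * Y₂) ^ (1 / 4 : ℝ) + 1) * (2 * Real.sqrt X₂ / Real.sqrt (Y₁ / 2) + 1)
      ≤ (5 * (M * N) ^ (1 / 4 : ℝ)) * (7 * (Real.sqrt M / Real.sqrt N)) :=
        mul_le_mul hf1 hf2 hf20 (by positivity)
    _ = _ := by ring

/-- `(MN)^{1/4} (√M/√N) N = (MN)^{3/4}` and `(√M/√N) N = √(MN)`. [folklore] -/
theorem fiSector_rpow_quarter_mul {M N : ℝ} (hM : 0 < M) (hN : 0 < N) :
    (M * N) ^ (1 / 4 : ℝ) * (Real.sqrt M / Real.sqrt N) * N = (M * N) ^ (3 / 4 : ℝ) ∧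
      Real.sqrt M / Real.sqrt N * N = Real.sqrt (M * N) ∧
      (M * N) ^ (1 / 4 : ℝ) * Real.sqrt (M * N) = (M * N) ^ (3 / 4 : ℝ) := by
  have hsN : 0 < Real.sqrt N := Real.sqrt_pos.mpr hN
  have h2 : Real.sqrt M / Real.sqrt N * N = Real.sqrt (M * N) := by
    have e : N / Real.sqrt N = Real.sqrt N := by
      rw [div_eq_iff hsN.ne']; exact (Real.mul_self_sqrt hN.le).symm
    calc Real.sqrt M / Real.sqrt N * N = Real.sqrt M * (N / Real.sqrt N) := by ring
      _ = Real.sqrt M * Real.sqrt N := by rw [e]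
      _ = Real.sqrt (M * N) := (Real.sqrt_mul hM.le N).symm
  have h3 : (M * N) ^ (1 / 4 : ℝ) * Real.sqrt (M * N) = (M * N) ^ (3 / 4 : ℝ) := by
    rw [Real.sqrt_eq_rpow, ← Real.rpow_add (by positivity)]; norm_num
  refine ⟨?_, h2, h3⟩
  rw [mul_assoc, h2, h3]

/-! ### The three totals -/

/-- **Near-axis total**: the explicit near-axis bound is `≤ 22050 ϖ θ (MN)^{3/4} (log MN)⁴`.
[cite: FriedlanderIwaniecAnnals1998, §5, "contribute no more than the bound (4.23) by the estimate (5.16)"] -/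
theorem fiSector_nearAxis_total_le {M N ϖ θ : ℝ} {X₂ Y₁ Y₂ W D : ℕ} (hN : 1 ≤ N) (hMN : N ≤ M)
    (hX₂ : (X₂ : ℝ) ≤ 2 * M) (hY₁ : N / 2 < Y₁) (hY₂ : (Y₂ : ℝ) ≤ 3 * N) (hY12 : Y₁ ≤ Y₂)
    (hΔ : (Y₂ : ℝ) - Y₁ ≤ 3 * θ * N) (hθ : 0 ≤ θ) (hϖ : 0 ≤ ϖ)
    (hW : 2 * (W : ℝ) + 1 ≤ 5 * ϖ * Real.sqrt N) (hD5 : 5 * (D : ℝ) ≤ θ * Real.sqrt N)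
    (hL0 : 0 ≤ 1 + Real.log D) (hL : 1 + Real.log D ≤ Real.log (M * N)) :
    ((2 * ((X₂ : ℝ) * Y₂) ^ (1 / 4 : ℝ) + 1) * (2 * Real.sqrt X₂ / Real.sqrt (Y₁ / 2) + 1)) *
        (18 * (2 * (W : ℝ) + 1) * (1 + Real.log D) ^ 4 *
          (2 * ((Y₂ : ℝ) - Y₁) / Real.sqrt (2 * Y₁) + 5 * D)) ≤
      22050 * ϖ * θ * (M * N) ^ (3 / 4 : ℝ) * Real.log (M * N) ^ 4 := by
  have hN0 : 0 < N := by linarith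
  have hM0 : 0 < M := by linarith
  have hsN : 0 < Real.sqrt N := Real.sqrt_pos.mpr hN0
  have hIn := fiSector_InB_le hN hMN hX₂ hY₁ hY₂
  have hL4 : (1 + Real.log D) ^ 4 ≤ Real.log (M * N) ^ 4 := pow_le_pow_left₀ hL0 hL 4
  -- the radial term
  have hY₁0 : (0 : ℝ) < Y₁ := by linarith
  have hs2Y : Real.sqrt N ≤ Real.sqrt (2 * Y₁) := Real.sqrt_le_sqrt (by linarith)
  have hs2Y0 : 0 < Real.sqrt (2 * Y₁) := Real.sqrt_pos.mpr (by linarith)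
  have hrad : 2 * ((Y₂ : ℝ) - Y₁) / Real.sqrt (2 * Y₁) ≤ 6 * θ * Real.sqrt N := by
    rw [div_le_iff₀ hs2Y0]
    have h1 : 6 * θ * Real.sqrt N * Real.sqrt N ≤ 6 * θ * Real.sqrt N * Real.sqrt (2 * Y₁) :=
      mul_le_mul_of_nonneg_left hs2Y (by positivity)
    have h2 : 6 * θ * Real.sqrt N * Real.sqrt N = 6 * θ * N := by
      rw [mul_assoc, Real.mul_self_sqrt hN0.le]
    nlinarith
  have hlast : 2 * ((Y₂ : ℝ) - Y₁) / Real.sqrt (2 * Y₁) + 5 * D ≤ 7 * θ * Real.sqrt N := by linarith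
  have hlast0 : 0 ≤ 2 * ((Y₂ : ℝ) - Y₁) / Real.sqrt (2 * Y₁) + 5 * D := by
    have : (0 : ℝ) ≤ (Y₂ : ℝ) - Y₁ := by
      have : ((Y₁ : ℕ) : ℝ) ≤ Y₂ := by exact_mod_cast hY12
      linarith
    positivity
  have hf10 : 0 ≤ (2 * ((X₂ : ℝ) * Y₂) ^ (1 / 4 : ℝ) + 1) * (2 * Real.sqrt X₂ / Real.sqrt (Y₁ / 2) + 1) := by
    have : 0 ≤ 2 * Real.sqrt X₂ / Real.sqrt (Y₁ / 2) := by positivity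
    positivity
  have hW0 : 0 ≤ 2 * (W : ℝ) + 1 := by positivity
  have key := (fiSector_rpow_quarter_mul hM0 hN0).1
  calc _ ≤ (35 * (M * N) ^ (1 / 4 : ℝ) * (Real.sqrt M / Real.sqrt N)) *
        (18 * (5 * ϖ * Real.sqrt N) * Real.log (M * N) ^ 4 * (7 * θ * Real.sqrt N)) := by
        refine mul_le_mul hIn ?_ (by positivity) (by positivity)
        refine mul_le_mul (mul_le_mul (mul_le_mul_of_nonneg_left hW (by norm_num)) hL4
          (by positivity) (by positivity)) hlast hlast0 (by positivity)
    _ = 22050 * ϖ * θ * Real.log (M * N) ^ 4 *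
        ((M * N) ^ (1 / 4 : ℝ) * (Real.sqrt M / Real.sqrt N) * (Real.sqrt N * Real.sqrt N)) := by ring
    _ = 22050 * ϖ * θ * (M * N) ^ (3 / 4 : ℝ) * Real.log (M * N) ^ 4 := by
        rw [Real.mul_self_sqrt hN0.le, key]; ring

/-- **Complementary total**: with the three admissibility conditions ((5.11)-type: `P` large,
`N ≤ ϑθ√(MN)`-type, `MN` large), the complementary form is `≤ 3 ϑθ (MN)^{3/4} (log MN)⁴`.
[cite: FriedlanderIwaniecAnnals1998, (5.10)-(5.11)] -/
theorem fiSector_compl_total_le {M N P τ ϑ θ : ℝ} {X₂ Y₁ Y₂ : ℕ} (hN : 1 ≤ N) (hMN : N ≤ M)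
    (hX₂ : (X₂ : ℝ) ≤ 2 * M) (hY₁ : N / 2 < Y₁) (hY₂ : (Y₂ : ℝ) ≤ 3 * N) (hP : 0 < P)
    (hϑθ : 0 ≤ ϑ * θ) (hi : 1450 * τ ^ 2 ≤ ϑ * θ * P)
    (hii : 125 * τ ^ 2 * N ≤ ϑ * θ * Real.sqrt (M * N))
    (hiii : 175 * τ ^ 2 ≤ ϑ * θ * (M * N) ^ (1 / 4 : ℝ)) (hlog : 1 ≤ Real.log (M * N)) :
    τ ^ 2 * (2 * Real.sqrt Y₂ + 1) ^ 2 *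
        ((2 * ((X₂ : ℝ) * Y₂) ^ (1 / 4 : ℝ) + 1) * (2 * Real.sqrt X₂ / (P * Real.sqrt (Y₁ / 2)) + 1) +
          (2 * ((X₂ : ℝ) * Y₂) ^ (1 / 4 : ℝ) / P + 1) * (2 * Real.sqrt X₂ / Real.sqrt (Y₁ / 2) + 1)) ≤
      3 * (ϑ * θ) * (M * N) ^ (3 / 4 : ℝ) * Real.log (M * N) ^ 4 := by
  have hN0 : 0 < N := by linarith
  have hM0 : 0 < M := by linarith
  have hsN : 0 < Real.sqrt N := Real.sqrt_pos.mpr hN0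
  have hT := fiSector_T0_le hN0.le hM0.le hX₂ hY₂
  have hR := fiSector_ratio_le hN0 hX₂ hY₁
  obtain ⟨k1, k2, k3⟩ := fiSector_rpow_quarter_mul hM0 hN0
  have ha0 : 0 ≤ (M * N) ^ (1 / 4 : ℝ) := by positivity
  set a : ℝ := (M * N) ^ (1 / 4 : ℝ) with ha
  set ρ : ℝ := Real.sqrt M / Real.sqrt N with hρ
  have hρ1 : 1 ≤ ρ := by
    rw [hρ, le_div_iff₀ hsN, one_mul]; exact Real.sqrt_le_sqrt hMN
  -- `(2√Y₂ + 1)² ≤ 25 N`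
  have hsq : (2 * Real.sqrt Y₂ + 1) ^ 2 ≤ 25 * N := by
    have h1 : Real.sqrt Y₂ ≤ 2 * Real.sqrt N := by
      calc Real.sqrt Y₂ ≤ Real.sqrt (4 * N) := Real.sqrt_le_sqrt (by linarith)
        _ = 2 * Real.sqrt N := by
            rw [Real.sqrt_mul (by norm_num), show (4 : ℝ) = 2 ^ 2 by norm_num, Real.sqrt_sq (by norm_num)]
    have h2 : 1 ≤ Real.sqrt N := by rw [Real.one_le_sqrt]; exact hN
    have h3 : 2 * Real.sqrt Y₂ + 1 ≤ 5 * Real.sqrt N := by linarith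
    calc (2 * Real.sqrt Y₂ + 1) ^ 2 ≤ (5 * Real.sqrt N) ^ 2 :=
          pow_le_pow_left₀ (by positivity) h3 2
      _ = 25 * N := by rw [mul_pow, Real.sq_sqrt hN0.le]; ring
  -- `CB ≤ 58 a ρ / P + 5 a + 7 ρ`
  have hq0 : 0 < Real.sqrt (Y₁ / 2) := Real.sqrt_pos.mpr (by linarith)
  have hCB : (2 * ((X₂ : ℝ) * Y₂) ^ (1 / 4 : ℝ) + 1) * (2 * Real.sqrt X₂ / (P * Real.sqrt (Y₁ / 2)) + 1) +
      (2 * ((X₂ : ℝ) * Y₂) ^ (1 / 4 : ℝ) / P + 1) * (2 * Real.sqrt X₂ / Real.sqrt (Y₁ / 2) + 1) ≤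
      58 * a * ρ / P + 5 * a + 7 * ρ := by
    have e1 : 2 * Real.sqrt X₂ / (P * Real.sqrt (Y₁ / 2)) = (2 * Real.sqrt X₂ / Real.sqrt (Y₁ / 2)) / P := by
      field_simp
    rw [e1]
    have h1 : (2 * Real.sqrt X₂ / Real.sqrt (Y₁ / 2)) / P ≤ 6 * ρ / P :=
      div_le_div_of_nonneg_right hR hP.le
    have h2 : 2 * ((X₂ : ℝ) * Y₂) ^ (1 / 4 : ℝ) / P ≤ 4 * a / P := by
      refine div_le_div_of_nonneg_right ?_ hP.le; linarith
    have h3 : 2 * ((X₂ : ℝ) * Y₂) ^ (1 / 4 : ℝ) + 1 ≤ 5 * a := by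
      have ha1 : 1 ≤ a := by rw [ha]; exact Real.one_le_rpow (by nlinarith) (by norm_num)
      linarith
    have h4 : 2 * Real.sqrt X₂ / Real.sqrt (Y₁ / 2) + 1 ≤ 7 * ρ := by linarith
    have hx0 : 0 ≤ 2 * Real.sqrt X₂ / Real.sqrt (Y₁ / 2) := by positivity
    have hT0 : 0 ≤ ((X₂ : ℝ) * Y₂) ^ (1 / 4 : ℝ) := by positivity
    have haP : 0 ≤ 4 * a / P := by positivity
    have hρP : 0 ≤ 6 * ρ / P := by positivity
    calc _ ≤ (5 * a) * (6 * ρ / P + 1) + (4 * a / P + 1) * (7 * ρ) := by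
          refine add_le_add ?_ ?_
          · exact mul_le_mul h3 (by linarith) (by positivity) (by positivity)
          · exact mul_le_mul (by linarith) h4 (by positivity) (by linarith)
      _ = 58 * a * ρ / P + 5 * a + 7 * ρ := by ring
  have hCB0 : 0 ≤ 58 * a * ρ / P + 5 * a + 7 * ρ := by positivity
  -- the three terms
  have t1 : τ ^ 2 * (25 * N) * (58 * a * ρ / P) ≤ (ϑ * θ) * (M * N) ^ (3 / 4 : ℝ) := by
    have e : τ ^ 2 * (25 * N) * (58 * a * ρ / P) = (1450 * τ ^ 2 / P) * (a * ρ * N) := by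
      field_simp; ring
    rw [e, k1]
    refine mul_le_mul_of_nonneg_right ?_ (by positivity)
    rw [div_le_iff₀ hP]; exact hi
  have t2 : τ ^ 2 * (25 * N) * (5 * a) ≤ (ϑ * θ) * (M * N) ^ (3 / 4 : ℝ) := by
    have e : τ ^ 2 * (25 * N) * (5 * a) = (125 * τ ^ 2 * N) * a := by ring
    rw [e, ← k3]
    calc 125 * τ ^ 2 * N * a ≤ (ϑ * θ * Real.sqrt (M * N)) * a := mul_le_mul_of_nonneg_right hii ha0
      _ = ϑ * θ * (a * Real.sqrt (M * N)) := by ring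
  have t3 : τ ^ 2 * (25 * N) * (7 * ρ) ≤ (ϑ * θ) * (M * N) ^ (3 / 4 : ℝ) := by
    have e : τ ^ 2 * (25 * N) * (7 * ρ) = (175 * τ ^ 2) * (ρ * N) := by ring
    rw [e, k2, ← k3]
    calc 175 * τ ^ 2 * Real.sqrt (M * N) ≤ (ϑ * θ * a) * Real.sqrt (M * N) :=
          mul_le_mul_of_nonneg_right hiii (Real.sqrt_nonneg _)
      _ = ϑ * θ * (a * Real.sqrt (M * N)) := by ring
  have hX0 : 0 ≤ (ϑ * θ) * (M * N) ^ (3 / 4 : ℝ) := by positivity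
  have hL4 : 1 ≤ Real.log (M * N) ^ 4 := one_le_pow₀ hlog
  calc _ ≤ τ ^ 2 * (25 * N) * (58 * a * ρ / P + 5 * a + 7 * ρ) := by
        exact mul_le_mul (mul_le_mul_of_nonneg_left hsq (by positivity)) hCB
          (by
            have : 0 ≤ 2 * Real.sqrt X₂ / (P * Real.sqrt (Y₁ / 2)) := by positivity
            have : 0 ≤ 2 * Real.sqrt X₂ / Real.sqrt (Y₁ / 2) := by positivity
            positivity)
          (by positivity)
    _ = τ ^ 2 * (25 * N) * (58 * a * ρ / P) + τ ^ 2 * (25 * N) * (5 * a) +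
          τ ^ 2 * (25 * N) * (7 * ρ) := by ring
    _ ≤ 3 * ((ϑ * θ) * (M * N) ^ (3 / 4 : ℝ)) := by linarith
    _ ≤ 3 * ((ϑ * θ) * (M * N) ^ (3 / 4 : ℝ)) * Real.log (M * N) ^ 4 :=
        le_mul_of_one_le_right (by positivity) hL4
    _ = _ := by ring

/-! ### The bound at a fixed `x` -/

/-- **(4.23) from (5.15) at fixed outer data.** With `ϑ, θ, τ` the values of (4.16), (4.15), (4.11)
at some large `x`, the 515-bound `SectorBoundAt K ϑ θ …` for every class and every off-axis sector,
and the elementary side conditions (all eventually true along (4.4), (4.6), (4.19)):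
`‖ℬ*(M, N)‖ ≤ (384 M_ψ K + 210000 + 3) ϑ θ (MN)^{3/4} (log MN)⁴`.
The three terms: the `≤ 3/θ` good arcs through (5.15) and the `64` classes (5.7); the near-axis arcs
(total angle `≤ 2(πϑ + 2πθ) · 4`) through (5.16); the complementary form through (5.10).
[cite: FriedlanderIwaniecAnnals1998, §5, (5.6)-(5.16)] -/
theorem norm_fiBilinearStar_le_at {K ϑ θ M N N' C P τ Mψ : ℝ} {p : ℝ → ℝ} {α : ℕ → ℂ}
    (hS : SectorBoundAt K ϑ θ M N N' C P τ p) (hK : 0 < K)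
    (hMψ : 1 ≤ Mψ) (hM' : ∀ s, |deriv Real.smoothTransition s| ≤ Mψ)
    (hM'' : ∀ s, |deriv (deriv Real.smoothTransition) s| ≤ Mψ)
    (hα : ∀ m, ‖α m‖ ≤ 1) (hp : ∀ u, |p u| ≤ 1)
    (hθ : 0 < θ) (hθ1 : θ ≤ 1 / 2) (hϑ : 0 < ϑ) (hθϑ : θ ≤ ϑ) (hϖ : π * ϑ + 2 * π * θ ≤ 1 / 4)
    (hP : 2 < P) (hN2 : 2 ≤ N) (hNN' : N < N') (hN'2 : N' < 2 * N) (hθN : 1 ≤ θ * N)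
    (hϖN : 1 ≤ π * ϑ * Real.sqrt N) (hMN : N ≤ M)
    (hDθ : 5 * (3 * N) ^ (1 / 3 : ℝ) ≤ θ * Real.sqrt N)
    (hlog : 2 + (Real.log 3 + Real.log N) / 3 ≤ Real.log (M * N))
    (hi : 1450 * τ ^ 2 ≤ ϑ * θ * P) (hii : 125 * τ ^ 2 * N ≤ ϑ * θ * Real.sqrt (M * N))
    (hiii : 175 * τ ^ 2 ≤ ϑ * θ * (M * N) ^ (1 / 4 : ℝ)) (hτ : 0 ≤ τ) :
    ‖fiBilinearStar α p M N' θ C P τ‖ ≤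
      (384 * Mψ * K + 210000 + 3) * ϑ * θ * (M * N) ^ (3 / 4 : ℝ) * Real.log (M * N) ^ 4 := by
  classical
  -- notation and elementary facts
  have hN1 : 1 ≤ N := by linarith
  have hN0 : 0 < N := by linarith
  have hM0 : 0 < M := by linarith
  have hπ3 : π < 3.15 := Real.pi_lt_d2
  have hπ0 : 0 < π := Real.pi_pos
  set ϖ : ℝ := π * ϑ + 2 * π * θ with hϖdef
  have hϖ0 : 0 < ϖ := by positivity
  have hϖϑ : ϖ ≤ 9.45 * ϑ := by
    have h1 : 2 * π * θ ≤ 2 * π * ϑ := by nlinarith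
    have h2 : π * ϑ ≤ 3.15 * ϑ := mul_le_mul_of_nonneg_right hπ3.le hϑ.le
    rw [hϖdef]; linarith
  have hϖN' : 1 ≤ ϖ * Real.sqrt N := by
    refine hϖN.trans ?_
    have : π * ϑ ≤ ϖ := by rw [hϖdef]; nlinarith
    exact mul_le_mul_of_nonneg_right this (Real.sqrt_nonneg _)
  obtain ⟨hY₁pos, hY12, hY₁gt, hY₁le, hY₂le, hY₂1, hΔ⟩ := fiSector_floor_facts hN2 hNN' hN'2 hθ hθ1 hθN
  set Y₁ := ⌊N'⌋₊ with hY₁def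
  set Y₂ := ⌊(1 + θ) * N'⌋₊ with hY₂def
  have hX₂ : ((⌊2 * M⌋₊ : ℕ) : ℝ) ≤ 2 * M := Nat.floor_le (by linarith)
  set W := ⌊ϖ * Real.sqrt Y₂⌋₊ with hWdef
  obtain ⟨hW2, hW5⟩ := fiSector_W_facts hN0 hY₁gt hY₂le hϖ0 hϖ hϖN'
  set D := ⌊(Y₂ : ℝ) ^ (1 / 3 : ℝ)⌋₊ with hDdef
  obtain ⟨hDd, hD5, hLD0, hLD⟩ := fiSector_D_facts (M := M) hN1 hY₂1 hY₂le hDθ hlog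
  have hlog1 : 1 ≤ Real.log (M * N) := by
    have : 0 ≤ (Real.log 3 + Real.log N) / 3 := by
      have h3 : 0 ≤ Real.log 3 := Real.log_nonneg (by norm_num)
      have hNl : 0 ≤ Real.log N := Real.log_nonneg hN1
      positivity
    linarith
  have hXpos : 0 ≤ ϑ * θ * (M * N) ^ (3 / 4 : ℝ) * Real.log (M * N) ^ 4 := by positivity
  -- the arcs
  set J := angCount θ with hJ
  set good : ℕ → Prop := fun j => ∃ k : ℤ, k * (π / 2) + π * ϑ < angStart θ j ∧
    angStart θ j + 2 * π * θ < (k + 1) * (π / 2) - π * ϑ with hgood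
  set G := (range J).filter good with hG
  have hGsub : G ⊆ range J := filter_subset _ _
  -- Step 0: split
  refine (norm_fiBilinearStar_le_split α p hP hθ hθ1 hGsub).trans ?_
  -- Step 1: the good arcs
  have hgoodsum : ∑ j ∈ G, ‖fiFreeSector α (angPiece θ j) p M N' θ C P τ‖ ≤
      384 * Mψ * K * (ϑ * θ * (M * N) ^ (3 / 4 : ℝ) * Real.log (M * N) ^ 4) := by
    have hKx : 0 ≤ K * ϑ * θ ^ 2 * (M * N) ^ (3 / 4 : ℝ) * Real.log (M * N) ^ 4 := by positivity
    have hterm : ∀ j ∈ G, ‖fiFreeSector α (angPiece θ j) p M N' θ C P τ‖ ≤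
        64 * (2 * Mψ) * (K * ϑ * θ ^ 2 * (M * N) ^ (3 / 4 : ℝ) * Real.log (M * N) ^ 4) := by
      intro j hj
      obtain ⟨-, hjg⟩ := mem_filter.mp hj
      exact norm_fiFreeSector_angPiece_le hS hθ hθ1 hMψ hM' hM'' hjg hKx hα
    have hcard : (#G : ℝ) ≤ 3 / θ := by
      calc (#G : ℝ) ≤ #(range J) := by exact_mod_cast card_le_card hGsub
        _ = J := by rw [card_range]
        _ ≤ 3 / θ := angCount_le hθ (by linarith)
    calc ∑ j ∈ G, ‖fiFreeSector α (angPiece θ j) p M N' θ C P τ‖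
        ≤ ∑ j ∈ G, 64 * (2 * Mψ) * (K * ϑ * θ ^ 2 * (M * N) ^ (3 / 4 : ℝ) * Real.log (M * N) ^ 4) :=
          sum_le_sum hterm
      _ = #G * (64 * (2 * Mψ) * (K * ϑ * θ ^ 2 * (M * N) ^ (3 / 4 : ℝ) * Real.log (M * N) ^ 4)) := by
          rw [sum_const, nsmul_eq_mul]
      _ ≤ (3 / θ) * (64 * (2 * Mψ) * (K * ϑ * θ ^ 2 * (M * N) ^ (3 / 4 : ℝ) * Real.log (M * N) ^ 4)) :=
          mul_le_mul_of_nonneg_right hcard (by positivity)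
      _ = 384 * Mψ * K * (ϑ * θ * (M * N) ^ (3 / 4 : ℝ) * Real.log (M * N) ^ 4) := by
          field_simp; ring
  -- Step 2: the near-axis arcs
  have hbadsum : ‖fiFreeSector α (fun u => ∑ j ∈ range J \ G, angPiece θ j u) p M N' θ C P τ‖ ≤
      210000 * (ϑ * θ * (M * N) ^ (3 / 4 : ℝ) * Real.log (M * N) ^ 4) := by
    have hq0 : ∀ u, 0 ≤ ∑ j ∈ range J \ G, angPiece θ j u := fun u =>
      sum_nonneg fun j _ => angPiece_nonneg hθ hθ1 j u
    have hq1 : ∀ u, ∑ j ∈ range J \ G, angPiece θ j u ≤ 1 := by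
      intro u
      calc ∑ j ∈ range J \ G, angPiece θ j u ≤ ∑ j ∈ range J, angPiece θ j u :=
            sum_le_sum_of_subset_of_nonneg sdiff_subset fun j _ _ => angPiece_nonneg hθ hθ1 j u
        _ = 1 := sum_angPiece hθ hθ1 u
    have hqW : ∀ n ∈ Ioc Y₁ Y₂, ∀ z ∈ primaryNormEq n,
        (∑ j ∈ range J \ G, angPiece θ j (gaussArg z)) ≠ 0 → z.re.natAbs ≤ W ∨ z.im.natAbs ≤ W := by
      intro n hn z hz hne
      obtain ⟨j, hj, hjne⟩ := exists_ne_zero_of_sum_ne_zero hne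
      have hj' := Finset.mem_sdiff.mp hj
      have hbad : ¬ good j := fun h => hj'.2 (mem_filter.mpr ⟨hj'.1, h⟩)
      have hu := angPiece_support hθ hθ1 hjne
      obtain ⟨k, hk⟩ := exists_abs_sub_mul_pi_div_two_le (φ := angStart θ j) (w := 2 * π * θ)
        (ϑ' := π * ϑ) (u := gaussArg z) hbad hu
      have hk' : |gaussArg z - k * (π / 2)| ≤ ϖ := by rw [hϖdef]; exact hk
      obtain ⟨hzn, -⟩ := mem_primaryNormEq.mp hz
      have hn2 : (n : ℝ) ≤ Y₂ := by exact_mod_cast (mem_Ioc.mp hn).2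
      have hsn : ϖ * Real.sqrt (z.norm : ℝ) ≤ ϖ * Real.sqrt Y₂ := by
        rw [hzn]; push_cast
        exact mul_le_mul_of_nonneg_left (Real.sqrt_le_sqrt hn2) hϖ0.le
      rcases abs_re_le_or_abs_im_le_of_arg hk' with h | h
      · left
        refine Nat.le_floor ?_
        rw [Nat.cast_natAbs, Int.cast_abs]; exact h.trans hsn
      · right
        refine Nat.le_floor ?_
        rw [Nat.cast_natAbs, Int.cast_abs]; exact h.trans hsn
    have h1 := norm_fiFreeSector_nearAxis_le hα hq0 hq1 hp (M := M) (C := C) (P := P) (τ := τ)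
      hqW hY₁pos hY12 hW2 hDd
    have hW5' : 2 * ((W : ℕ) : ℝ) + 1 ≤ 5 * ϖ * Real.sqrt N := hW5
    have h2 := fiSector_nearAxis_total_le (X₂ := ⌊2 * M⌋₊) hN1 hMN hX₂ hY₁gt hY₂le hY12 hΔ hθ.le hϖ0.le
      hW5' hD5 hLD0 hLD
    have h3 : ‖fiFreeSector α (fun u => ∑ j ∈ range J \ G, angPiece θ j u) p M N' θ C P τ‖ ≤
        22050 * ϖ * θ * (M * N) ^ (3 / 4 : ℝ) * Real.log (M * N) ^ 4 := h1.trans h2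
    refine h3.trans ?_
    have : 22050 * ϖ ≤ 210000 * ϑ := by linarith
    calc 22050 * ϖ * θ * (M * N) ^ (3 / 4 : ℝ) * Real.log (M * N) ^ 4
        = (22050 * ϖ) * (θ * (M * N) ^ (3 / 4 : ℝ) * Real.log (M * N) ^ 4) := by ring
      _ ≤ (210000 * ϑ) * (θ * (M * N) ^ (3 / 4 : ℝ) * Real.log (M * N) ^ 4) :=
          mul_le_mul_of_nonneg_right this (by positivity)
      _ = _ := by ring
  -- Step 3: the complementary form
  have hcompl : ‖fiGaussCompl α p M N' θ C P τ‖ ≤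
      3 * (ϑ * θ * (M * N) ^ (3 / 4 : ℝ) * Real.log (M * N) ^ 4) := by
    have h1 := norm_fiGaussCompl_le_explicit hα hp (M := M) (C := C) (θ := θ) (N' := N') hP hτ hY₁pos
    refine h1.trans ?_
    have h2 := fiSector_compl_total_le (X₂ := ⌊2 * M⌋₊) (Y₂ := Y₂) (τ := τ) hN1 hMN hX₂ hY₁gt hY₂le
      (by linarith) (by positivity) hi hii hiii hlog1
    exact h2.trans (le_of_eq (by ring))
  -- total
  have e : (384 * Mψ * K + 210000 + 3) * ϑ * θ * (M * N) ^ (3 / 4 : ℝ) * Real.log (M * N) ^ 4 =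
      384 * Mψ * K * (ϑ * θ * (M * N) ^ (3 / 4 : ℝ) * Real.log (M * N) ^ 4) +
      210000 * (ϑ * θ * (M * N) ^ (3 / 4 : ℝ) * Real.log (M * N) ^ 4) +
      3 * (ϑ * θ * (M * N) ^ (3 / 4 : ℝ) * Real.log (M * N) ^ 4) := by ring
  rw [e]
  exact add_le_add (add_le_add hgoodsum hbadsum) hcompl

/-! ### From (5.15) to (4.23), pointwise in `x, P, N, C` -/

/-- **(4.23) from (5.15), pointwise**: at fixed `x, P, N, C`, the sector bound `Sector515At` with
constant `K` gives `BilinBoundAt` with constant `384 M_ψ K + 210003`, under the elementary side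
conditions of `norm_fiBilinearStar_le_at` (those depending on `M` only through the lower bound
`MN > x(log x)^{-A₂}` are asked for all such `M`). [cite: FriedlanderIwaniecAnnals1998, §5, (5.6)-(5.16)] -/
theorem bilinBoundAt_of_sector515At {x P N C A₂ θ τ ϑ K Mψ : ℝ}
    (hS : Sector515At x P N C A₂ θ τ ϑ K) (hK : 0 < K)
    (hMψ : 1 ≤ Mψ) (hM' : ∀ s, |deriv Real.smoothTransition s| ≤ Mψ)
    (hM'' : ∀ s, |deriv (deriv Real.smoothTransition) s| ≤ Mψ)
    (hθ : 0 < θ) (hθ1 : θ ≤ 1 / 2) (hϑ : 0 < ϑ) (hθϑ : θ ≤ ϑ) (hϖ : π * ϑ + 2 * π * θ ≤ 1 / 4)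
    (hP : 2 < P) (hi : 1450 * τ ^ 2 ≤ ϑ * θ * P) (hτ : 0 ≤ τ)
    (hN2 : 2 ≤ N) (hθN : 1 ≤ θ * N) (hϖN : 1 ≤ π * ϑ * Real.sqrt N)
    (hDθ : 5 * (3 * N) ^ (1 / 3 : ℝ) ≤ θ * Real.sqrt N)
    (hM : ∀ M : ℝ, x / Real.log x ^ A₂ < M * N →
      N ≤ M ∧ 2 + (Real.log 3 + Real.log N) / 3 ≤ Real.log (M * N) ∧
        125 * τ ^ 2 * N ≤ ϑ * θ * Real.sqrt (M * N) ∧ 175 * τ ^ 2 ≤ ϑ * θ * (M * N) ^ (1 / 4 : ℝ)) :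
    BilinBoundAt x P N C A₂ θ τ ϑ (384 * Mψ * K + 210000 + 3) := by
  intro M hM1 hM2 N' hN'1 hN'2 p hp hsupp hp0 hp1 hp2 α hα
  obtain ⟨hMN, hlog, hii, hiii⟩ := hM M hM1
  exact norm_fiBilinearStar_le_at (hS M hM1 hM2 N' hN'1 hN'2 p hp hsupp hp0 hp1 hp2) hK hMψ hM' hM''
    hα hp0 hθ hθ1 hϑ hθϑ hϖ hP hN2 hN'1 hN'2 hθN hϖN hMN hDθ hlog hi hii hiii hτ

/-! ### The side conditions along (4.4), (4.6), (4.19): elementary asymptotics -/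

/-- `3^{1/3} ≤ 3/2`. [folklore] -/
theorem rpow_three_third_le : (3 : ℝ) ^ (1 / 3 : ℝ) ≤ 3 / 2 := by
  have e : (3 / 2 : ℝ) = ((3 / 2 : ℝ) ^ (3 : ℕ)) ^ ((3 : ℕ) : ℝ)⁻¹ :=
    (Real.pow_rpow_inv_natCast (by norm_num) (by norm_num)).symm
  rw [e, show (1 / 3 : ℝ) = ((3 : ℕ) : ℝ)⁻¹ by norm_num]
  exact Real.rpow_le_rpow (by norm_num) (by norm_num) (by positivity)

/-- The `P`-conditions from (4.4) for positive `P`: `P > 2` and `1450 τ² ≤ ϑθ P` once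
`log log x ≥ 1450 + 2t + A + A'`. [cite: FriedlanderIwaniecAnnals1998, (4.4), (5.11)] -/
theorem P_conditions {L P t A A' : ℝ} (hL : 1 < L) (hP0 : 0 < P) (ht : 0 ≤ 2 * t + A + A')
    (hu : 1450 + (2 * t + A + A') ≤ Real.log L) (hP1 : Real.log L ^ 2 ≤ Real.log P) :
    2 < P ∧ 1450 * (L ^ t) ^ 2 ≤ L ^ (-A) * L ^ (-A') * P := by
  have hL0 : 0 < L := by linarith
  set u := Real.log L with hu'
  have hu0 : 0 < u := Real.log_pos hL
  have hu1 : 1 ≤ u := by linarith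
  -- `log P ≥ u² ≥ 1450 + (2t + A + A') u`
  have hlogP : 1450 + (2 * t + A + A') * u ≤ Real.log P := by
    have h1 : (1450 + (2 * t + A + A')) * u ≤ u ^ 2 := by nlinarith
    nlinarith
  have h1450 : Real.log 1450 ≤ 1449 := by
    have := Real.log_le_sub_one_of_pos (by norm_num : (0 : ℝ) < 1450); linarith
  constructor
  · by_contra hle
    push Not at hle
    have h1 := Real.log_le_log hP0 hle
    have h2 : Real.log 2 < 1 := by linarith [Real.log_two_lt_d9]
    nlinarith
  · have hkey : 1450 * L ^ (2 * t + A + A') ≤ P := by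
      rw [← Real.log_le_log_iff (by positivity) hP0, Real.log_mul (by norm_num) (by positivity),
        Real.log_rpow hL0]
      linarith
    have e1 : (L ^ t) ^ 2 = L ^ (2 * t) := by
      rw [← Real.rpow_natCast, ← Real.rpow_mul hL0.le]; ring_nf
    have e2 : L ^ (-A) * L ^ (-A') * (1450 * L ^ (2 * t + A + A')) = 1450 * L ^ (2 * t) := by
      have : L ^ (-A) * L ^ (-A') * L ^ (2 * t + A + A') = L ^ (2 * t) := by
        rw [← Real.rpow_add hL0, ← Real.rpow_add hL0]; ring_nf
      calc L ^ (-A) * L ^ (-A') * (1450 * L ^ (2 * t + A + A'))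
          = 1450 * (L ^ (-A) * L ^ (-A') * L ^ (2 * t + A + A')) := by ring
        _ = 1450 * L ^ (2 * t) := by rw [this]
    rw [e1, ← e2]
    exact mul_le_mul_of_nonneg_left hkey (by positivity)

/-- The `N`-conditions from (4.6): `θN ≥ 1`, `N ≥ 2`, `πϑ√N ≥ 1`, `5(3N)^{1/3} ≤ θ√N`, given
`(log x)^{A'} ≤ x^{1/4}`, `(log x)^A ≤ x^{1/8}`, `7.5 (log x)^{A'} ≤ x^{1/24}`, `θ ≤ 1/40`.
[cite: FriedlanderIwaniecAnnals1998, (4.6)] -/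
theorem N_conditions {x L N A A' η : ℝ} (hx : 1 < x) (hL0 : 0 < L) (hη : 0 < η)
    (hN : x ^ (1 / 4 + η : ℝ) < N) (h5 : L ^ A' ≤ x ^ (1 / 4 : ℝ)) (h6 : L ^ A ≤ x ^ (1 / 8 : ℝ))
    (h7 : 7.5 * L ^ A' ≤ x ^ (1 / 24 : ℝ)) (hθ40 : L ^ (-A') ≤ 1 / 40) :
    1 ≤ L ^ (-A') * N ∧ 2 ≤ N ∧ 1 ≤ π * L ^ (-A) * Real.sqrt N ∧
      5 * (3 * N) ^ (1 / 3 : ℝ) ≤ L ^ (-A') * Real.sqrt N := by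
  have hx0 : 0 < x := by linarith
  have hx14 : x ^ (1 / 4 : ℝ) ≤ N :=
    ((Real.rpow_le_rpow_of_exponent_le hx.le (by linarith)).trans hN.le)
  have hx14pos : 0 < x ^ (1 / 4 : ℝ) := Real.rpow_pos_of_pos hx0 _
  have hN0 : 0 < N := hx14pos.trans_le hx14
  have hθ0 : 0 < L ^ (-A') := Real.rpow_pos_of_pos hL0 _
  have hθinv : L ^ (-A') * L ^ A' = 1 := by
    rw [← Real.rpow_add hL0]; simp
  have hϑinv : L ^ (-A) * L ^ A = 1 := by
    rw [← Real.rpow_add hL0]; simp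
  -- `θN ≥ 1`
  have h1 : 1 ≤ L ^ (-A') * N := by
    calc (1 : ℝ) = L ^ (-A') * L ^ A' := hθinv.symm
      _ ≤ L ^ (-A') * N := mul_le_mul_of_nonneg_left (h5.trans hx14) hθ0.le
  -- `N ≥ 40 ≥ 2`
  have h2 : 2 ≤ N := by
    have : 1 ≤ (1 / 40) * N := h1.trans (mul_le_mul_of_nonneg_right hθ40 hN0.le)
    linarith
  -- `√N ≥ x^{1/8} ≥ L^A`
  have hsqrt : x ^ (1 / 8 : ℝ) ≤ Real.sqrt N := by
    calc x ^ (1 / 8 : ℝ) = Real.sqrt (x ^ (1 / 4 : ℝ)) := by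
          rw [Real.sqrt_eq_rpow, ← Real.rpow_mul hx0.le]; norm_num
      _ ≤ Real.sqrt N := Real.sqrt_le_sqrt hx14
  have h3 : 1 ≤ π * L ^ (-A) * Real.sqrt N := by
    have hϑ0 : 0 < L ^ (-A) := Real.rpow_pos_of_pos hL0 _
    have h31 : 1 ≤ L ^ (-A) * Real.sqrt N := by
      calc (1 : ℝ) = L ^ (-A) * L ^ A := hϑinv.symm
        _ ≤ L ^ (-A) * Real.sqrt N := mul_le_mul_of_nonneg_left (h6.trans hsqrt) hϑ0.le
    have hπ : (1 : ℝ) ≤ π := by linarith [Real.pi_gt_three]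
    calc (1 : ℝ) ≤ 1 * (L ^ (-A) * Real.sqrt N) := by linarith
      _ ≤ π * (L ^ (-A) * Real.sqrt N) := mul_le_mul_of_nonneg_right hπ (by positivity)
      _ = _ := by ring
  -- `5 (3N)^{1/3} ≤ θ √N`
  have h4 : 5 * (3 * N) ^ (1 / 3 : ℝ) ≤ L ^ (-A') * Real.sqrt N := by
    have hN16 : x ^ (1 / 24 : ℝ) ≤ N ^ (1 / 6 : ℝ) := by
      calc x ^ (1 / 24 : ℝ) = (x ^ (1 / 4 : ℝ)) ^ (1 / 6 : ℝ) := by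
            rw [← Real.rpow_mul hx0.le]; norm_num
        _ ≤ N ^ (1 / 6 : ℝ) := Real.rpow_le_rpow hx14pos.le hx14 (by norm_num)
    have hθN6 : 7.5 ≤ L ^ (-A') * N ^ (1 / 6 : ℝ) := by
      calc (7.5 : ℝ) = L ^ (-A') * (7.5 * L ^ A') := by
            rw [mul_comm (7.5 : ℝ), ← mul_assoc, hθinv, one_mul]
        _ ≤ L ^ (-A') * N ^ (1 / 6 : ℝ) := mul_le_mul_of_nonneg_left (h7.trans hN16) hθ0.le
    have h3N : (3 * N) ^ (1 / 3 : ℝ) ≤ 3 / 2 * N ^ (1 / 3 : ℝ) := by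
      rw [Real.mul_rpow (by norm_num) hN0.le]
      exact mul_le_mul_of_nonneg_right rpow_three_third_le (by positivity)
    have hsplit : Real.sqrt N = N ^ (1 / 6 : ℝ) * N ^ (1 / 3 : ℝ) := by
      rw [Real.sqrt_eq_rpow, ← Real.rpow_add hN0]; norm_num
    have hN13 : 0 ≤ N ^ (1 / 3 : ℝ) := by positivity
    calc 5 * (3 * N) ^ (1 / 3 : ℝ) ≤ 5 * (3 / 2 * N ^ (1 / 3 : ℝ)) := by linarith
      _ = 7.5 * N ^ (1 / 3 : ℝ) := by ring
      _ ≤ (L ^ (-A') * N ^ (1 / 6 : ℝ)) * N ^ (1 / 3 : ℝ) := mul_le_mul_of_nonneg_right hθN6 hN13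
      _ = L ^ (-A') * Real.sqrt N := by rw [hsplit]; ring
  exact ⟨h1, h2, h3, h4⟩

/-- The `M`-conditions from (4.19) (lower bound `MN > x(log x)^{-A₂}`) and (4.6) with `B'` large:
`M ≥ N`, `log MN ≥ 2 + (log 3 + log N)/3`, `125τ²N ≤ ϑθ√(MN)`, `175τ² ≤ ϑθ(MN)^{1/4}`.
[cite: FriedlanderIwaniecAnnals1998, (4.19), (5.11)] -/
theorem M_conditions {x L N M A A' A₂ B' t : ℝ} (hx : 1 < x) (hLx : Real.log x = L) (hL : 125 ≤ L)
    (hN0 : 0 < N) (hN2 : N < x ^ (1 / 2 : ℝ) / L ^ B') (hM1 : x / L ^ A₂ < M * N)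
    (hB' : 2 * t + A + A' + A₂ / 2 + 1 ≤ B') (hA₂ : 0 ≤ A₂) (ht : 0 ≤ 2 * t + A + A')
    (h8 : 4 * A₂ * L ^ (1 / 2 : ℝ) ≤ L)
    (h9 : 175 * L ^ (2 * t + A + A' + A₂ / 4) ≤ x ^ (1 / 4 : ℝ)) :
    N ≤ M ∧ 2 + (Real.log 3 + Real.log N) / 3 ≤ Real.log (M * N) ∧
      125 * (L ^ t) ^ 2 * N ≤ L ^ (-A) * L ^ (-A') * Real.sqrt (M * N) ∧
      175 * (L ^ t) ^ 2 ≤ L ^ (-A) * L ^ (-A') * (M * N) ^ (1 / 4 : ℝ) := by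
  have hx0 : 0 < x := by linarith
  have hL0 : 0 < L := by linarith
  have hL1 : 1 ≤ L := by linarith
  have hxL : 0 < x / L ^ A₂ := by positivity
  have hMN0 : 0 < M * N := hxL.trans hM1
  have hM0 : 0 < M := by
    by_contra h; push Not at h
    have : M * N ≤ 0 := mul_nonpos_of_nonpos_of_nonneg h hN0.le
    linarith
  have e1 : (L ^ t) ^ 2 = L ^ (2 * t) := by
    rw [← Real.rpow_natCast, ← Real.rpow_mul hL0.le]; ring_nf
  have hBpow : L ^ (A₂ / 2) ≤ L ^ B' := Real.rpow_le_rpow_of_exponent_le hL1 (by linarith)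
  -- `N² ≤ x / L^{A₂}`
  have hN2' : N ≤ x ^ (1 / 2 : ℝ) / L ^ (A₂ / 2) :=
    hN2.le.trans (div_le_div_of_nonneg_left (by positivity) (by positivity) hBpow)
  have hsq : (x ^ (1 / 2 : ℝ) / L ^ (A₂ / 2)) ^ 2 = x / L ^ A₂ := by
    rw [div_pow, ← Real.rpow_natCast, ← Real.rpow_natCast, ← Real.rpow_mul hx0.le,
      ← Real.rpow_mul hL0.le]
    norm_num
  have hNsq : N ^ 2 ≤ x / L ^ A₂ := by
    rw [← hsq]; exact pow_le_pow_left₀ hN0.le hN2' 2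
  refine ⟨?_, ?_, ?_, ?_⟩
  · -- `N ≤ M`
    by_contra h; push Not at h
    have : M * N < N ^ 2 := by nlinarith
    linarith
  · -- the logarithm
    have hlogMN : L - A₂ * Real.log L ≤ Real.log (M * N) := by
      have := Real.log_le_log hxL hM1.le
      rwa [Real.log_div hx0.ne' (by positivity), Real.log_rpow hL0, hLx] at this
    have hlogN : Real.log N ≤ L / 2 := by
      have h1 : N ≤ x ^ (1 / 2 : ℝ) := by
        refine hN2.le.trans (div_le_self (by positivity) (Real.one_le_rpow hL1 ?_))
        linarith
      have := Real.log_le_log hN0 h1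
      rwa [Real.log_rpow hx0, hLx, mul_comm, ← div_eq_mul_one_div] at this
    have hlog3 : Real.log 3 ≤ 2 := by
      have := Real.log_le_sub_one_of_pos (by norm_num : (0 : ℝ) < 3); linarith
    have hlogL : A₂ * Real.log L ≤ L / 2 := by
      have h1 : Real.log L ≤ L ^ (1 / 2 : ℝ) / (1 / 2) := Real.log_le_rpow_div hL0.le (by norm_num)
      have h2 : A₂ * Real.log L ≤ A₂ * (2 * L ^ (1 / 2 : ℝ)) := by
        refine mul_le_mul_of_nonneg_left ?_ hA₂; linarith
      linarith
    linarith
  · -- `125 τ² N ≤ ϑθ √(MN)`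
    have hsqrt : x ^ (1 / 2 : ℝ) / L ^ (A₂ / 2) ≤ Real.sqrt (M * N) := by
      rw [show x ^ (1 / 2 : ℝ) / L ^ (A₂ / 2) = Real.sqrt (x / L ^ A₂) by
        rw [← hsq, Real.sqrt_sq (by positivity)]]
      exact Real.sqrt_le_sqrt hM1.le
    -- compare `125 L^{2t} · x^{1/2} L^{-B'}` with `L^{-A-A'} x^{1/2} L^{-A₂/2}`
    have hexp : 125 * L ^ (2 * t) * (L ^ B')⁻¹ ≤ L ^ (-A) * L ^ (-A') * (L ^ (A₂ / 2))⁻¹ := by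
      rw [← Real.rpow_neg hL0.le, ← Real.rpow_neg hL0.le, mul_assoc, ← Real.rpow_add hL0,
        ← Real.rpow_add hL0, ← Real.rpow_add hL0]
      -- `125 L^{2t - B'} ≤ L^{-A - A' - A₂/2}`: `125 ≤ L ≤ L^{B' - 2t - A - A' - A₂/2}`
      have h1 : (125 : ℝ) * L ^ (2 * t + -B') = 125 * L ^ (-(B' - (2 * t + A + A' + A₂ / 2))) *
          L ^ (-A + -A' + -(A₂ / 2)) := by
        rw [mul_assoc, ← Real.rpow_add hL0]; ring_nf
      rw [h1]
      refine mul_le_of_le_one_left (by positivity) ?_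
      rw [Real.rpow_neg hL0.le, mul_inv_le_iff₀ (by positivity), one_mul]
      calc (125 : ℝ) ≤ L := hL
        _ = L ^ (1 : ℝ) := (Real.rpow_one L).symm
        _ ≤ L ^ (B' - (2 * t + A + A' + A₂ / 2)) := Real.rpow_le_rpow_of_exponent_le hL1 (by linarith)
    calc 125 * (L ^ t) ^ 2 * N ≤ 125 * L ^ (2 * t) * (x ^ (1 / 2 : ℝ) / L ^ B') := by
          rw [e1]; exact mul_le_mul_of_nonneg_left hN2.le (by positivity)
      _ = (125 * L ^ (2 * t) * (L ^ B')⁻¹) * x ^ (1 / 2 : ℝ) := by ring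
      _ ≤ (L ^ (-A) * L ^ (-A') * (L ^ (A₂ / 2))⁻¹) * x ^ (1 / 2 : ℝ) :=
          mul_le_mul_of_nonneg_right hexp (by positivity)
      _ = L ^ (-A) * L ^ (-A') * (x ^ (1 / 2 : ℝ) / L ^ (A₂ / 2)) := by ring
      _ ≤ L ^ (-A) * L ^ (-A') * Real.sqrt (M * N) :=
          mul_le_mul_of_nonneg_left hsqrt (by positivity)
  · -- `175 τ² ≤ ϑθ (MN)^{1/4}`
    have hq : x ^ (1 / 4 : ℝ) / L ^ (A₂ / 4) ≤ (M * N) ^ (1 / 4 : ℝ) := by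
      have e : x ^ (1 / 4 : ℝ) / L ^ (A₂ / 4) = (x / L ^ A₂) ^ (1 / 4 : ℝ) := by
        rw [Real.div_rpow hx0.le (by positivity), ← Real.rpow_mul hL0.le]; ring_nf
      rw [e]; exact Real.rpow_le_rpow hxL.le hM1.le (by norm_num)
    have hexp : 175 * L ^ (2 * t) ≤ L ^ (-A) * L ^ (-A') * (x ^ (1 / 4 : ℝ) / L ^ (A₂ / 4)) := by
      have e : L ^ (-A) * L ^ (-A') * (x ^ (1 / 4 : ℝ) / L ^ (A₂ / 4)) =
          x ^ (1 / 4 : ℝ) * L ^ (-(2 * t + A + A' + A₂ / 4)) * L ^ (2 * t) := by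
        rw [div_eq_mul_inv, ← Real.rpow_neg hL0.le]
        have : L ^ (-A) * L ^ (-A') * L ^ (-(A₂ / 4)) = L ^ (-(2 * t + A + A' + A₂ / 4)) * L ^ (2 * t) := by
          rw [← Real.rpow_add hL0, ← Real.rpow_add hL0, ← Real.rpow_add hL0]; ring_nf
        calc L ^ (-A) * L ^ (-A') * (x ^ (1 / 4 : ℝ) * L ^ (-(A₂ / 4)))
            = x ^ (1 / 4 : ℝ) * (L ^ (-A) * L ^ (-A') * L ^ (-(A₂ / 4))) := by ring
          _ = _ := by rw [this]; ring
      rw [e]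
      refine mul_le_mul_of_nonneg_right ?_ (by positivity)
      rw [Real.rpow_neg hL0.le, ← div_eq_mul_inv, le_div_iff₀ (by positivity)]
      linarith
    calc 175 * (L ^ t) ^ 2 = 175 * L ^ (2 * t) := by rw [e1]
      _ ≤ L ^ (-A) * L ^ (-A') * (x ^ (1 / 4 : ℝ) / L ^ (A₂ / 4)) := hexp
      _ ≤ L ^ (-A) * L ^ (-A') * (M * N) ^ (1 / 4 : ℝ) := mul_le_mul_of_nonneg_left hq (by positivity)

/-! ### (4.23) from (5.15): the quantified form -/

/-- **FI (4.23) from (5.15)** (§5 of the source, PROVED): if for every `η > 0`, `A > 0` there are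
`A' ≥ 2A + 2^20`, `t ≥ A + 124`, `B > 0`, `K > 0` such that for all large `x`, all POSITIVE `P` in
(4.4), all `N` in (4.6) and `1 ≤ C ≤ N^{1-η}`, the sector bound (5.15) holds in the shape
`Sector515At x P N C (2A+8) θ τ ϑ K` (every `M` with `x(log x)^{-2A-8} < MN < x`, every
`N < N' < 2N`, every admissible `p`, class `z₀`, off-axis sector and admissible `q`, every `|α| ≤ 1`:
`‖B(M,N)‖ ≤ K ϑθ²(MN)^{3/4}(log MN)⁴`), then the same holds with `BilinBoundAt` ((4.23):
`‖B*(M,N)‖ ≤ K' ϑθ(MN)^{3/4}(log MN)⁴`) in place of `Sector515At` — the hypothesis of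
`FriedlanderIwaniec1998_prop41_of_bilinear423` restricted to `P > 0` (for `P ≤ 0` the condition
`(log log x)² ≤ log P` of the tree's statements is an artefact of `Real.log`; the source's `P` is a
sieving range of primes). Route: (5.6) `B* = Σ` over Gaussian integers (`P > 2` makes `n` odd);
(5.10) coprimality removed at admissible cost (`P ≥ 1450 τ² (ϑθ)⁻¹`, `N ≤ ϑθ√(MN)`-type conditions
met by enlarging `B`); classes modulo `8` (5.7); the angular partition (5.12); (5.15) on the arcs
off the axes; (5.16) on the `O(ϑ/θ)` arcs near the axes.
[cite: FriedlanderIwaniecAnnals1998, §5, (5.6)-(5.16); §4 (4.19)-(4.23); §18] -/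
theorem FriedlanderIwaniec1998_bilinBound_of_sectorBound
    (h : ∀ η : ℝ, 0 < η → ∀ A : ℝ, 0 < A →
      ∃ A' t B K : ℝ, 2 * A + 2 ^ 20 ≤ A' ∧ A + 124 ≤ t ∧ 0 < B ∧ 0 < K ∧
      ∀ᶠ x : ℝ in atTop,
        ∀ P : ℝ, 0 < P → Real.log (Real.log x) ^ 2 ≤ Real.log P →
          Real.log P ≤ Real.log x * (Real.log (Real.log x))⁻¹ ^ 2 →
        ∀ N : ℝ, x ^ (1 / 4 + η : ℝ) < N → N < x ^ (1 / 2 : ℝ) / Real.log x ^ B →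
        ∀ C : ℝ, 1 ≤ C → C ≤ N ^ (1 - η : ℝ) →
          Sector515At x P N C (2 * A + 8) (Real.log x ^ (-A')) (Real.log x ^ t)
            (Real.log x ^ (-A)) K) :
    ∀ η : ℝ, 0 < η → ∀ A : ℝ, 0 < A →
      ∃ A' t B K : ℝ, 2 * A + 2 ^ 20 ≤ A' ∧ A + 124 ≤ t ∧ 0 < B ∧ 0 < K ∧
      ∀ᶠ x : ℝ in atTop,
        ∀ P : ℝ, 0 < P → Real.log (Real.log x) ^ 2 ≤ Real.log P →
          Real.log P ≤ Real.log x * (Real.log (Real.log x))⁻¹ ^ 2 →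
        ∀ N : ℝ, x ^ (1 / 4 + η : ℝ) < N → N < x ^ (1 / 2 : ℝ) / Real.log x ^ B →
        ∀ C : ℝ, 1 ≤ C → C ≤ N ^ (1 - η : ℝ) →
          BilinBoundAt x P N C (2 * A + 8) (Real.log x ^ (-A')) (Real.log x ^ t)
            (Real.log x ^ (-A)) K := by
  intro η hη A hA
  obtain ⟨A', t, B, K, hA', ht, hB, hK, hev⟩ := h η hη A hA
  obtain ⟨Mψ, hMψ, hM', hM''⟩ := exists_bound_deriv_smoothTransition
  set A₂ : ℝ := 2 * A + 8 with hA₂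
  set B' : ℝ := max B (2 * t + A + A' + A₂ / 2 + 1) with hB'
  refine ⟨A', t, B', 384 * Mψ * K + 210000 + 3, hA', ht, lt_max_of_lt_left hB, by positivity, ?_⟩
  have hBB' : B ≤ B' := le_max_left _ _
  have hB'2 : 2 * t + A + A' + A₂ / 2 + 1 ≤ B' := le_max_right _ _
  have hA₂0 : 0 ≤ A₂ := by rw [hA₂]; linarith
  have ht0 : 0 ≤ 2 * t + A + A' := by linarith
  -- the eventualities
  have hll : Tendsto (fun x : ℝ => Real.log (Real.log x)) atTop atTop :=
    Real.tendsto_log_atTop.comp Real.tendsto_log_atTop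
  have e4 := eventually_mul_log_rpow_le (e₁ := 0) (e₂ := A) hA 40
  have e5 := eventually_mul_log_rpow_le_rpow A' (by norm_num : (0 : ℝ) < 1 / 4) 1
  have e6 := eventually_mul_log_rpow_le_rpow A (by norm_num : (0 : ℝ) < 1 / 8) 1
  have e7 := eventually_mul_log_rpow_le_rpow A' (by norm_num : (0 : ℝ) < 1 / 24) 7.5
  have e8 := eventually_mul_log_rpow_le (e₁ := 1 / 2) (e₂ := 1) (by norm_num) (4 * A₂)
  have e9 := eventually_mul_log_rpow_le_rpow (2 * t + A + A' + A₂ / 4) (by norm_num : (0 : ℝ) < 1 / 4) 175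
  filter_upwards [hev, Real.tendsto_log_atTop.eventually_ge_atTop (125 : ℝ),
    hll.eventually_ge_atTop (1450 + (2 * t + A + A')), e4, e5, e6, e7, e8, e9,
    eventually_gt_atTop (1 : ℝ)] with x hx hL hu h4 h5 h6 h7 h8 h9 hx1
  intro P hP0 hP1 hP2 N hN1 hN2 C hC1 hC2
  rw [Real.rpow_zero, mul_one] at h4
  rw [one_mul] at h5 h6
  rw [Real.rpow_one] at h8
  set L := Real.log x with hLdef
  have hL0 : 0 < L := by linarith
  have hL1 : 1 < L := by linarith
  have hL1' : 1 ≤ L := hL1.le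
  have hx0 : 0 < x := by linarith
  -- `θ ≤ ϑ ≤ 1/40`
  have hϑ0 : 0 < L ^ (-A) := Real.rpow_pos_of_pos hL0 _
  have hθ0 : 0 < L ^ (-A') := Real.rpow_pos_of_pos hL0 _
  have hθϑ : L ^ (-A') ≤ L ^ (-A) := Real.rpow_le_rpow_of_exponent_le hL1' (by linarith)
  have hϑ40 : L ^ (-A) ≤ 1 / 40 := by
    rw [Real.rpow_neg hL0.le, one_div]
    exact inv_anti₀ (by norm_num) h4
  have hθ40 : L ^ (-A') ≤ 1 / 40 := hθϑ.trans hϑ40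
  have hθ1 : L ^ (-A') ≤ 1 / 2 := by linarith
  have hϖ : π * L ^ (-A) + 2 * π * L ^ (-A') ≤ 1 / 4 := by
    have hπ := Real.pi_lt_d2
    nlinarith [Real.pi_pos]
  -- `P`
  have hP1' : Real.log L ^ 2 ≤ Real.log P := hP1
  obtain ⟨hP2', hi⟩ := P_conditions hL1 hP0 ht0 hu hP1'
  -- `N`
  obtain ⟨hθN, hN2', hϖN, hDθ⟩ := N_conditions hx1 hL0 hη hN1 h5 h6 h7 hθ40
  have hN0 : 0 < N := by linarith
  -- the fact at `x` (its `N`-range uses `B ≤ B'`)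
  have hN2B : N < x ^ (1 / 2 : ℝ) / Real.log x ^ B :=
    lt_of_lt_of_le hN2 (div_le_div_of_nonneg_left (by positivity) (by positivity)
      (Real.rpow_le_rpow_of_exponent_le hL1' hBB'))
  have hS : Sector515At x P N C A₂ (L ^ (-A')) (L ^ t) (L ^ (-A)) K :=
    hx P hP0 hP1 hP2 N hN1 hN2B C hC1 hC2
  -- `M`
  have hM : ∀ M : ℝ, x / Real.log x ^ A₂ < M * N →
      N ≤ M ∧ 2 + (Real.log 3 + Real.log N) / 3 ≤ Real.log (M * N) ∧
        125 * (L ^ t) ^ 2 * N ≤ L ^ (-A) * L ^ (-A') * Real.sqrt (M * N) ∧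
        175 * (L ^ t) ^ 2 ≤ L ^ (-A) * L ^ (-A') * (M * N) ^ (1 / 4 : ℝ) :=
    fun M hM1 => M_conditions hx1 hLdef.symm hL hN0 hN2 hM1 hB'2 hA₂0 ht0 h8 h9
  exact bilinBoundAt_of_sector515At hS hK hMψ hM' hM'' hθ0 hθ1 hϑ0 hθϑ hϖ hP2' hi
    (Real.rpow_nonneg hL0.le t) hN2' hθN hϖN hDθ hM

end Literature.NumberTheory.Sieve.FriedlanderIwaniecPrimes

namespace Literature.NumberTheory.Sieve

open FriedlanderIwaniecPrimes

/-! ### Proposition 4.1 for positive `P` from (4.23) for positive `P` -/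

/-- **FI Proposition 4.1 for positive `P` from (4.23) for positive `P`** (§4 of the source; the
proof of `FriedlanderIwaniec1998_prop41_of_bilinear423` with `0 < P` threaded through).
[cite: FriedlanderIwaniecAnnals1998, Proposition 4.1 and §4 (4.9)-(4.23)] -/
theorem FriedlanderIwaniec1998_prop41pos_of_bilinBound
    (h : (∀ η : ℝ, 0 < η → ∀ A : ℝ, 0 < A →
      ∃ A' t B K : ℝ, 2 * A + 2 ^ 20 ≤ A' ∧ A + 124 ≤ t ∧ 0 < B ∧ 0 < K ∧
      ∀ᶠ x : ℝ in atTop,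
        ∀ P : ℝ, 0 < P → Real.log (Real.log x) ^ 2 ≤ Real.log P →
          Real.log P ≤ Real.log x * (Real.log (Real.log x))⁻¹ ^ 2 →
        ∀ N : ℝ, x ^ (1 / 4 + η : ℝ) < N → N < x ^ (1 / 2 : ℝ) / Real.log x ^ B →
        ∀ C : ℝ, 1 ≤ C → C ≤ N ^ (1 - η : ℝ) →
          BilinBoundAt x P N C (2 * A + 8) (Real.log x ^ (-A')) (Real.log x ^ t)
            (Real.log x ^ (-A)) K)) :
    (∀ η : ℝ, 0 < η → ∀ A : ℝ, 0 < A → ∃ B : ℝ, 0 < B ∧ ∃ K : ℝ, ∀ᶠ x : ℝ in atTop,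
      ∀ P : ℝ, 0 < P → Real.log (Real.log x) ^ 2 ≤ Real.log P →
        Real.log P ≤ Real.log x * (Real.log (Real.log x))⁻¹ ^ 2 →
      ∀ N : ℝ, x ^ (1 / 4 + η : ℝ) < N → N < x ^ (1 / 2 : ℝ) / Real.log x ^ B →
      ∀ C : ℝ, 1 ≤ C → C ≤ N ^ (1 - η : ℝ) →
        fiSieveSeq.fiBilinearPi x N C P ≤ K * fiCount x * Real.log x ^ (4 - A : ℝ)) := by
  intro η hη A hA
  obtain ⟨A', t, B₀, K₀, hA', ht, hB₀, hK₀, hfact⟩ := h η hη A hA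
  obtain ⟨Mψ, hMψ, hM', hM''⟩ := exists_bound_deriv_smoothTransition
  obtain ⟨C₃, hC₃0, hC₃⟩ := exists_sum_sigma_zero_pow_div_le_real 3
  obtain ⟨C₃', hC₃'0, hC₃'⟩ := exists_sum_sigma_zero_pow_le_real 3
  obtain ⟨C₂, hC₂0, hC₂⟩ := exists_sum_sigma_zero_pow_div_le_real 2
  obtain ⟨C₂', hC₂'0, hC₂'⟩ := exists_sum_sigma_zero_pow_le_real 2
  obtain ⟨C₄', hC₄'0, hC₄'⟩ := exists_sum_sigma_zero_pow_le_real 4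
  have hκ := friedlanderIwaniecKappa_pos
  have hMψ0 : 0 ≤ Mψ := by linarith
  refine ⟨max B₀ (A + 10), lt_max_of_lt_left hB₀,
    (48 * Mψ * K₀ + 7) / (2 * friedlanderIwaniecKappa), ?_⟩
  have hBB₀ : B₀ ≤ max B₀ (A + 10) := le_max_left _ _
  have hBA : A + 10 ≤ max B₀ (A + 10) := le_max_right _ _
  -- eventualities, all independent of `N`
  have ev_θ := eventually_mul_log_rpow_le (e₁ := 0) (e₂ := A') (by linarith) 2
  have ev_θN := eventually_mul_log_rpow_le_rpow A' (by norm_num : (0 : ℝ) < 1 / 4) 1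
  have ev_xA := eventually_mul_log_rpow_le_rpow (2 * A + 8) one_pos 1
  have ev_E1 := eventually_le_target (e := 16 - t) (A := A) (by linarith)
    ((4 * friedlanderIwaniecKappa + 14) * C₃ + 18 * C₃')
  have ev_E2 := eventually_le_target (e := -A' / 2 + 16) (A := A) (by linarith)
    (Real.sqrt (8 * C₄') * ((4 * friedlanderIwaniecKappa + 14) + 9))
  have ev_E3a := eventually_le_target (e := -A' + 8) (A := A) (by linarith)
    (3 * (4 * friedlanderIwaniecKappa * C₂))
  have ev_E3b := eventually_sqrt_le_target A (3 * (28 * C₂))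
  have ev_E3c := eventually_le_target (e := -max B₀ (A + 10) + 8) (A := A) (by linarith)
    (3 * (18 * C₂'))
  have ev_E4a := eventually_le_target (e := (2 * A + 7) * (-(3 / 4 : ℝ)) + 8) (A := A) (by nlinarith)
    (2 * ((4 * friedlanderIwaniecKappa + 14) * C₂ * 4))
  have ev_E4b := eventually_le_target (e := (2 * A + 7) * (-(1 / 4 : ℝ)) + -max B₀ (A + 10) + 8)
    (A := A) (by nlinarith) (2 * (72 * C₂'))
  filter_upwards [hfact, fiCount_bounds FriedlanderIwaniec1998_count_asymp_holds, ev_θ, ev_θN, ev_xA,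
    ev_E1, ev_E2, ev_E3a, ev_E3b, ev_E3c, ev_E4a, ev_E4b, eventually_ge_atTop (16 : ℝ)]
    with x hfx hcnt hxθ hxθN hxA hxE1 hxE2 hxE3a hxE3b hxE3c hxE4a hxE4b hx16
  intro P hP0 hP1 hP2 N hN1 hN2 C hC1 hC2
  rw [Real.rpow_zero, mul_one] at hxθ
  rw [one_mul] at hxθN
  rw [one_mul, Real.rpow_one] at hxA
  have hx1 : 1 < x := by linarith
  have hlog1 : 1 ≤ Real.log x :=
    le_of_lt (one_lt_two.trans (two_lt_log_sixteen.trans_le (Real.log_le_log (by norm_num) hx16)))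
  -- the `N`-range of the fact and the fact at `x`
  have hN2' : N < x ^ (1 / 2 : ℝ) / Real.log x ^ B₀ :=
    lt_of_lt_of_le hN2 (div_le_div_of_nonneg_left (by positivity) (by positivity)
      (Real.rpow_le_rpow_of_exponent_le hlog1 hBB₀))
  have hBat : BilinBoundAt x P N C (2 * A + 8) (Real.log x ^ (-A')) (Real.log x ^ t)
      (Real.log x ^ (-A)) K₀ :=
    hfx P hP0 hP1 hP2 N hN1 hN2' C hC1 hC2
  have hx14 : x ^ (1 / 4 : ℝ) ≤ N :=
    ((Real.rpow_le_rpow_of_exponent_le hx1.le (by linarith)).trans hN1.le)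
  have hAt := fiBilinearPi_le_at hBat hMψ hM' hM'' hK₀.le hA (by linarith) hC₃ hC₃' hC₂ hC₂' hC₄'
    hC₃0.le hC₃'0.le hC₂0.le hC₂'0.le hC₄'0.le hx16 hxθ hxθN hxA hxE1 hxE2 hxE3a hxE3b hxE3c
    hxE4a hxE4b hx14 hN2.le
  -- `x^{3/4} ≤ A(x)/(2κ)`
  have hTA : x ^ (3 / 4 : ℝ) * Real.log x ^ (4 - A) ≤
      fiCount x * Real.log x ^ (4 - A) / (2 * friedlanderIwaniecKappa) := by
    rw [le_div_iff₀ (by positivity)]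
    have hl : 0 ≤ Real.log x ^ (4 - A) := by positivity
    nlinarith [hcnt.1]
  calc fiSieveSeq.fiBilinearPi x N C P ≤ (48 * Mψ * K₀ + 7) * (x ^ (3 / 4 : ℝ) * Real.log x ^ (4 - A)) := hAt
    _ ≤ (48 * Mψ * K₀ + 7) * (fiCount x * Real.log x ^ (4 - A) / (2 * friedlanderIwaniecKappa)) :=
        mul_le_mul_of_nonneg_left hTA (by positivity)
    _ = (48 * Mψ * K₀ + 7) / (2 * friedlanderIwaniecKappa) * fiCount x * Real.log x ^ (4 - A) := by
        ring


/-! ### (2.11), (2.1)–(2.15) for `a'` and (4.7)–(4.8), from Proposition 4.1 for positive `P` -/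

namespace FriedlanderIwaniecPrimesSquarefree

/-- **(2.11) for `a'`** from Proposition 4.1 for positive `P` (`η = 1/25`, `A = 2^{26} + 5`), as
`hyp211_sq` (the fact being used at `P = exp((log log x)²) > 0` only).
[cite: FriedlanderIwaniecAnnals1998, Proposition 4.1 and (2.11)-(2.15)] -/
theorem hyp211_sq_pos (h41 : (∀ η : ℝ, 0 < η → ∀ A : ℝ, 0 < A → ∃ B : ℝ, 0 < B ∧ ∃ K : ℝ, ∀ᶠ x : ℝ in atTop,
      ∀ P : ℝ, 0 < P → Real.log (Real.log x) ^ 2 ≤ Real.log P →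
        Real.log P ≤ Real.log x * (Real.log (Real.log x))⁻¹ ^ 2 →
      ∀ N : ℝ, x ^ (1 / 4 + η : ℝ) < N → N < x ^ (1 / 2 : ℝ) / Real.log x ^ B →
      ∀ C : ℝ, 1 ≤ C → C ≤ N ^ (1 - η : ℝ) →
        fiSieveSeq.fiBilinearPi x N C P ≤ K * fiCount x * Real.log x ^ (4 - A : ℝ))) (h35 : FriedlanderIwaniec1998_prop35) :
    ∃ B : ℝ, 0 < B ∧ ∀ᶠ x : ℝ in atTop, ∀ C : ℝ, 1 ≤ C → C ≤ x / x ^ (17 / 25 : ℝ) →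
      ∀ N : ℝ, Real.sqrt (x ^ (17 / 25 : ℝ)) / x ^ fiEps < N → N < Real.sqrt x / Real.log x ^ B →
        fiSieveSeqSq.fiBilinearPi x N C (fiP x) ≤ fiSieveSeqSq.size x / Real.log x ^ (2 ^ 26 : ℕ) := by
  obtain ⟨B, hB, K, hev⟩ := h41 (1 / 25) (by norm_num) (2 ^ 26 + 5) (by norm_num)
  refine ⟨B, hB, ?_⟩
  have hll : Tendsto (fun x : ℝ => Real.log (Real.log x)) atTop atTop :=
    Real.tendsto_log_atTop.comp Real.tendsto_log_atTop
  have h44 : ∀ᶠ x : ℝ in atTop, ‖Real.log (Real.log x) ^ 4‖ ≤ 1 * ‖Real.log x‖ :=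
    ((Real.isLittleO_pow_log_id_atTop (n := 4)).comp_tendsto Real.tendsto_log_atTop).def one_pos
  filter_upwards [hev, eventually_gt_atTop 1, h44, hll.eventually_ge_atTop 1,
    Real.tendsto_log_atTop.eventually_ge_atTop (max K 1 * Real.exp 7), fiCountSq_bounds h35]
    with x hx hx1 h3 h4 h5 hb
  intro C hC1 hC2 N hN1 hN2
  have hx0 : 0 < x := zero_lt_one.trans hx1
  have hlog0 : 0 < Real.log x := Real.log_pos hx1
  have hll0 : 0 < Real.log (Real.log x) := zero_lt_one.trans_le h4
  -- the range (4.4) for `P = exp((log log x)²)`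
  have hP1 : Real.log (Real.log x) ^ 2 ≤ Real.log (fiP x) := by rw [fiP, Real.log_exp]
  have hP2 : Real.log (fiP x) ≤ Real.log x * (Real.log (Real.log x))⁻¹ ^ 2 := by
    rw [fiP, Real.log_exp, Real.norm_eq_abs, Real.norm_eq_abs, abs_of_nonneg (by positivity),
      abs_of_pos hlog0, one_mul] at *
    rw [inv_pow, ← div_eq_mul_inv, le_div_iff₀ (by positivity)]
    calc Real.log (Real.log x) ^ 2 * Real.log (Real.log x) ^ 2 = Real.log (Real.log x) ^ 4 := by ring
      _ ≤ Real.log x := h3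
  -- the range (4.6) for `N`
  have hlow : Real.sqrt (x ^ (17 / 25 : ℝ)) / x ^ fiEps = x ^ ((17 / 25 : ℝ) / 2 - fiEps) := by
    rw [Real.sqrt_eq_rpow, ← Real.rpow_mul hx0.le, ← Real.rpow_sub hx0]
    congr 1; ring
  rw [hlow] at hN1
  have hN0 : 0 < N := (Real.rpow_pos_of_pos hx0 _).trans hN1
  have hN1' : x ^ (1 / 4 + 1 / 25 : ℝ) < N :=
    (Real.rpow_le_rpow_of_exponent_le hx1.le (by norm_num [fiEps])).trans_lt hN1
  have hN2' : N < x ^ (1 / 2 : ℝ) / Real.log x ^ B := by rwa [Real.sqrt_eq_rpow] at hN2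
  -- the range `1 ≤ C ≤ N^{1 - η}`
  have hC2' : C ≤ N ^ (1 - 1 / 25 : ℝ) := by
    refine hC2.trans ?_
    have hxD : x / x ^ (17 / 25 : ℝ) = x ^ (8 / 25 : ℝ) := by
      rw [div_eq_iff (Real.rpow_pos_of_pos hx0 _).ne', ← Real.rpow_add hx0]
      conv_lhs => rw [← Real.rpow_one x]
      norm_num
    rw [hxD]
    calc x ^ (8 / 25 : ℝ)
        ≤ x ^ (((17 / 25 : ℝ) / 2 - fiEps) * (1 - 1 / 25) : ℝ) :=
          Real.rpow_le_rpow_of_exponent_le hx1.le (by norm_num [fiEps])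
      _ = (x ^ ((17 / 25 : ℝ) / 2 - fiEps : ℝ)) ^ (1 - 1 / 25 : ℝ) := Real.rpow_mul hx0.le _ _
      _ ≤ N ^ (1 - 1 / 25 : ℝ) := Real.rpow_le_rpow (by positivity) hN1.le (by norm_num)
  refine ((fiBilinearPi_sq_le x N C (fiP x)).trans (hx (fiP x) (Real.exp_pos _) hP1 hP2 N hN1' hN2' C hC1 hC2')).trans ?_
  -- `K A(x) (log x)^{4 - A} ≤ A'(x) (log x)^{-2^26}` once `log x ≥ K e⁷`
  change K * fiCount x * Real.log x ^ (4 - (2 ^ 26 + 5) : ℝ) ≤ fiCountSq x / Real.log x ^ (2 ^ 26 : ℕ)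
  have hA0 : 0 ≤ fiCount x := fiCount_nonneg x
  have hpow : Real.log x ^ (4 - (2 ^ 26 + 5) : ℝ) = (Real.log x ^ (2 ^ 26 : ℕ))⁻¹ * (Real.log x)⁻¹ := by
    rw [show (4 - (2 ^ 26 + 5) : ℝ) = -((2 ^ 26 + 1 : ℕ) : ℝ) by push_cast; ring,
      Real.rpow_neg hlog0.le, Real.rpow_natCast, pow_succ, mul_inv]
  rw [hpow, div_eq_mul_inv]
  have hK : max K 1 * Real.exp 7 ≤ Real.log x := h5
  have hK7 : K * fiCount x ≤ Real.log x * fiCountSq x := by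
    calc K * fiCount x ≤ max K 1 * fiCount x := mul_le_mul_of_nonneg_right (le_max_left _ _) hA0
      _ = max K 1 * Real.exp 7 * (Real.exp (-7) * fiCount x) := by
          rw [mul_assoc, ← mul_assoc (Real.exp 7), ← Real.exp_add]; norm_num
      _ ≤ Real.log x * fiCountSq x :=
          mul_le_mul hK hb.1 (by positivity) hlog0.le
  calc K * fiCount x * ((Real.log x ^ (2 ^ 26 : ℕ))⁻¹ * (Real.log x)⁻¹)
      = (K * fiCount x) * (Real.log x)⁻¹ * (Real.log x ^ (2 ^ 26 : ℕ))⁻¹ := by ring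
    _ ≤ (Real.log x * fiCountSq x) * (Real.log x)⁻¹ * (Real.log x ^ (2 ^ 26 : ℕ))⁻¹ := by
        gcongr
    _ = fiCountSq x * (Real.log x ^ (2 ^ 26 : ℕ))⁻¹ := by field_simp


/-- **The hypotheses (2.1)–(2.15) of Proposition 2.1 hold for `a'`**, from Proposition 3.5,
Proposition 4.1 for positive `P`, and (2.7) for `g` (as `sieveHypotheses_sq`).
[cite: FriedlanderIwaniecAnnals1998, §§2-4] -/
theorem sieveHypotheses_sq_pos (h35 : FriedlanderIwaniec1998_prop35) (h41 : (∀ η : ℝ, 0 < η → ∀ A : ℝ, 0 < A → ∃ B : ℝ, 0 < B ∧ ∃ K : ℝ, ∀ᶠ x : ℝ in atTop,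
      ∀ P : ℝ, 0 < P → Real.log (Real.log x) ^ 2 ≤ Real.log P →
        Real.log P ≤ Real.log x * (Real.log (Real.log x))⁻¹ ^ 2 →
      ∀ N : ℝ, x ^ (1 / 4 + η : ℝ) < N → N < x ^ (1 / 2 : ℝ) / Real.log x ^ B →
      ∀ C : ℝ, 1 ≤ C → C ≤ N ^ (1 - η : ℝ) →
        fiSieveSeq.fiBilinearPi x N C P ≤ K * fiCount x * Real.log x ^ (4 - A : ℝ)))
    (h27 : FriedlanderIwaniec1998_hyp27) :
    ∃ B : ℝ, 0 < B ∧ fiSieveSeqSq.FI1998SieveHypotheses (fun x => x ^ (17 / 25 : ℝ))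
      (fun x => Real.log x ^ B) (fun x => x ^ fiEps) fiP := by
  obtain ⟨B, hB, h211⟩ := hyp211_sq_pos h41 h35
  refine ⟨B, hB, fiSieveSeqSq_size_eq, hyp21_sq h35, hyp22_sq h35, fun p hp => fiDensitySq_hyp24 hp,
    ?_, hyp27_sq h27, hyp28_sq h35, ranges_sq hB, hyp29_sq h35, h211⟩
  refine ⟨3, fun p hp => ?_⟩
  obtain ⟨h1, h2⟩ := fiDensitySq_hyp2526 hp
  refine ⟨h1.trans ?_, h2⟩
  have : (0 : ℝ) < p := by exact_mod_cast hp.pos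
  change fiDensitySq p ≤ 2 / p at h1
  gcongr; norm_num


/-- **(4.7) with (4.8) for `a_n`** from ASP Theorem 1 with (B*) applied to `a'`, Proposition 3.5,
Proposition 4.1 for positive `P` and (2.7) (as `primeSum_asymp_of_rough_inputs`).
[cite: FriedlanderIwaniecAnnals1998, §4, (4.7)-(4.8)] -/
theorem primeSum_asymp_of_rough_inputs_pos (hR : fi_asymptotic_sieve_primes_rough_loglog)
    (h35 : FriedlanderIwaniec1998_prop35) (h41 : (∀ η : ℝ, 0 < η → ∀ A : ℝ, 0 < A → ∃ B : ℝ, 0 < B ∧ ∃ K : ℝ, ∀ᶠ x : ℝ in atTop,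
      ∀ P : ℝ, 0 < P → Real.log (Real.log x) ^ 2 ≤ Real.log P →
        Real.log P ≤ Real.log x * (Real.log (Real.log x))⁻¹ ^ 2 →
      ∀ N : ℝ, x ^ (1 / 4 + η : ℝ) < N → N < x ^ (1 / 2 : ℝ) / Real.log x ^ B →
      ∀ C : ℝ, 1 ≤ C → C ≤ N ^ (1 - η : ℝ) →
        fiSieveSeq.fiBilinearPi x N C P ≤ K * fiCount x * Real.log x ^ (4 - A : ℝ)))
    (h27 : FriedlanderIwaniec1998_hyp27) : FriedlanderIwaniec1998_primeSum_asymp := by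
  obtain ⟨B, hB, hhyp⟩ := sieveHypotheses_sq_pos h35 h41 h27
  set H' : ℝ := 4 / Real.pi / fiSqConst with hH'
  have hP := fiSqConst_pos
  have hH'0 : 0 < H' := by rw [hH']; positivity
  have hHP : H' * fiSqConst = 4 / Real.pi := by rw [hH']; field_simp
  have h := prop21_squarefree_of_rough_loglog hR fiSieveSeqSq (fun x => x ^ (17 / 25 : ℝ)) fiP B
    fiEps H' hB (by norm_num [fiEps]) (by norm_num [fiEps]) (fun n hn => fiSieveSeqSq_a_eq_zero hn)
    hhyp (hasDensityConstant_fiSieveSeqSq_of_densityConstant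
      FriedlanderIwaniec1998_densityConstant_holds)
  simp only [fiSieveSeqSq_primeSum] at h
  change (fun x => fiPrimeSum x - H' * fiCountSq x) =O[atTop]
    (fun x => H' * fiCountSq x * (Real.log (Real.log x) / Real.log x)) at h
  -- Step 1: `H' A'(x) ≤ (1/P_∞) (4/π) A(x)`
  have h1 : (fun x => fiPrimeSum x - H' * fiCountSq x) =O[atTop]
      (fun x => 4 / Real.pi * fiCount x * (Real.log (Real.log x) / Real.log x)) := by
    refine h.trans (Asymptotics.IsBigO.of_bound (1 / fiSqConst) (Filter.Eventually.of_forall fun x => ?_))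
    have hA' := fiCountSq_le_fiCount x
    have hA'0 := fiCountSq_nonneg x
    have hA0 := fiCount_nonneg x
    rw [Real.norm_eq_abs, Real.norm_eq_abs, abs_mul (H' * fiCountSq x), abs_mul (4 / Real.pi * fiCount x),
      abs_of_nonneg (mul_nonneg hH'0.le hA'0), abs_of_nonneg (mul_nonneg (by positivity) hA0)]
    calc H' * fiCountSq x * |Real.log (Real.log x) / Real.log x|
        ≤ H' * fiCount x * |Real.log (Real.log x) / Real.log x| := by gcongr
      _ = 1 / fiSqConst * (4 / Real.pi * fiCount x * |Real.log (Real.log x) / Real.log x|) := by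
          rw [hH']; field_simp
  -- Step 2: `H' A'(x) - (4/π) A(x) = H' (A'(x) - P_∞ A(x))` is `O(A(x) (x^{-1/500} + 1/x))`
  have h2 : (fun x => H' * fiCountSq x - 4 / Real.pi * fiCount x) =O[atTop]
      (fun x => 4 / Real.pi * fiCount x * (Real.log (Real.log x) / Real.log x)) := by
    have hll : Tendsto (fun x : ℝ => Real.log (Real.log x)) atTop atTop :=
      Real.tendsto_log_atTop.comp Real.tendsto_log_atTop
    have hl1 : ∀ᶠ x : ℝ in atTop, ‖Real.log x‖ ≤ 1 * ‖x ^ (1 / 500 : ℝ)‖ :=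
      (isLittleO_log_rpow_atTop (by norm_num : (0 : ℝ) < 1 / 500)).def one_pos
    have hl2 : ∀ᶠ x : ℝ in atTop, ‖Real.log x‖ ≤ 1 / 6 * ‖x ^ (1 : ℝ)‖ :=
      (isLittleO_log_rpow_atTop (by norm_num : (0 : ℝ) < 1)).def (by norm_num)
    refine Asymptotics.IsBigO.of_bound (2 / fiSqConst) ?_
    filter_upwards [levelSq_and_countSq h35, hl1, hl2, hll.eventually_ge_atTop 1,
      eventually_ge_atTop (2 : ℝ)] with x hlev hl1 hl2 hll1 hx2
    have hx0 : 0 < x := by linarith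
    have hx1 : 1 < x := by linarith
    have hlog0 : 0 < Real.log x := Real.log_pos hx1
    rw [Real.rpow_one] at hl2
    rw [Real.norm_eq_abs, Real.norm_eq_abs, abs_of_pos hlog0] at hl1 hl2
    rw [abs_of_nonneg (by positivity)] at hl1
    rw [abs_of_nonneg hx0.le] at hl2
    obtain ⟨hX1, hXle, hXge⟩ := floor_facts hx2
    have hA := fiCount_nonneg x
    -- `|A'(x) - P_∞ A(x)| ≤ A(x) (x^{-1/500} + 3/⌊x⌋)`
    have hd : |fiCountSq x - fiSqConst * fiCount x| ≤
        fiCount x * (x ^ (-(1 / 500 : ℝ)) + 3 / ⌊x⌋₊) := by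
      have e : fiCountSq x - fiSqConst * fiCount x =
          (fiCountSq x - fiSqProd ⌊x⌋₊ * fiCount x) + (fiSqProd ⌊x⌋₊ - fiSqConst) * fiCount x := by
        ring
      rw [e, mul_add]
      refine (abs_add_le _ _).trans (add_le_add (hlev.2 x le_rfl) ?_)
      rw [abs_mul, abs_of_nonneg hA, abs_of_nonneg (fiSqProd_sub_fiSqConst_le hX1).1, mul_comm]
      exact mul_le_mul_of_nonneg_left (fiSqProd_sub_fiSqConst_le hX1).2 hA
    -- `x^{-1/500} + 3/⌊x⌋ ≤ 2 / log x ≤ 2 log log x / log x`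
    have hsmall : x ^ (-(1 / 500 : ℝ)) + 3 / ⌊x⌋₊ ≤ 2 * (Real.log (Real.log x) / Real.log x) := by
      have e1 : x ^ (-(1 / 500 : ℝ)) ≤ 1 / Real.log x := by
        rw [Real.rpow_neg hx0.le, ← one_div, div_le_div_iff₀ (by positivity) hlog0]; linarith
      have e2 : 3 / (⌊x⌋₊ : ℝ) ≤ 1 / Real.log x := by
        rw [div_le_div_iff₀ (by exact_mod_cast hX1) hlog0]; linarith
      have e3 : 1 / Real.log x ≤ Real.log (Real.log x) / Real.log x :=
        div_le_div_of_nonneg_right hll1 hlog0.le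
      linarith
    have hr0 : 0 ≤ Real.log (Real.log x) / Real.log x := div_nonneg (by linarith) hlog0.le
    rw [Real.norm_eq_abs, Real.norm_eq_abs,
      abs_of_nonneg (mul_nonneg (mul_nonneg (by positivity) hA) hr0)]
    have e : H' * fiCountSq x - 4 / Real.pi * fiCount x = H' * (fiCountSq x - fiSqConst * fiCount x) := by
      rw [← hHP]; ring
    rw [e, abs_mul, abs_of_pos hH'0]
    calc H' * |fiCountSq x - fiSqConst * fiCount x|
        ≤ H' * (fiCount x * (x ^ (-(1 / 500 : ℝ)) + 3 / ⌊x⌋₊)) :=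
          mul_le_mul_of_nonneg_left hd hH'0.le
      _ ≤ H' * (fiCount x * (2 * (Real.log (Real.log x) / Real.log x))) := by gcongr
      _ = 2 / fiSqConst * (4 / Real.pi * fiCount x * (Real.log (Real.log x) / Real.log x)) := by
          rw [hH']; field_simp
  -- Step 3: add
  refine (h1.add h2).congr_left fun x => ?_
  ring


end FriedlanderIwaniecPrimesSquarefree

open FriedlanderIwaniecPrimesSquarefree

/-! ### Theorem 1 from Proposition 4.1 for positive `P`, and from (5.15) -/

/-- **FI (4.7)–(4.8) from Proposition 4.1 for positive `P` alone** (ASP Theorem 1 with (B*),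
Proposition 3.5 and (2.7) being theorems of the tree). [cite: FriedlanderIwaniecAnnals1998, §4, (4.7)-(4.8)] -/
theorem FriedlanderIwaniec1998_primeSum_asymp_of_prop41pos (h41 : (∀ η : ℝ, 0 < η → ∀ A : ℝ, 0 < A → ∃ B : ℝ, 0 < B ∧ ∃ K : ℝ, ∀ᶠ x : ℝ in atTop,
      ∀ P : ℝ, 0 < P → Real.log (Real.log x) ^ 2 ≤ Real.log P →
        Real.log P ≤ Real.log x * (Real.log (Real.log x))⁻¹ ^ 2 →
      ∀ N : ℝ, x ^ (1 / 4 + η : ℝ) < N → N < x ^ (1 / 2 : ℝ) / Real.log x ^ B →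
      ∀ C : ℝ, 1 ≤ C → C ≤ N ^ (1 - η : ℝ) →
        fiSieveSeq.fiBilinearPi x N C P ≤ K * fiCount x * Real.log x ^ (4 - A : ℝ))) :
    FriedlanderIwaniec1998_primeSum_asymp :=
  primeSum_asymp_of_rough_inputs_pos fi_asymptotic_sieve_primes_rough_loglog_holds
    FriedlanderIwaniec1998_prop35_holds h41 FriedlanderIwaniec1998_hyp27_holds

/-- **Friedlander–Iwaniec Theorem 1 (parity.S17) from Proposition 4.1 for positive `P` alone.**
[cite: FriedlanderIwaniecAnnals1998, Theorem 1] -/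
theorem friedlanderIwaniecSum_isEquivalent_of_prop41pos (h41 : (∀ η : ℝ, 0 < η → ∀ A : ℝ, 0 < A → ∃ B : ℝ, 0 < B ∧ ∃ K : ℝ, ∀ᶠ x : ℝ in atTop,
      ∀ P : ℝ, 0 < P → Real.log (Real.log x) ^ 2 ≤ Real.log P →
        Real.log P ≤ Real.log x * (Real.log (Real.log x))⁻¹ ^ 2 →
      ∀ N : ℝ, x ^ (1 / 4 + η : ℝ) < N → N < x ^ (1 / 2 : ℝ) / Real.log x ^ B →
      ∀ C : ℝ, 1 ≤ C → C ≤ N ^ (1 - η : ℝ) →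
        fiSieveSeq.fiBilinearPi x N C P ≤ K * fiCount x * Real.log x ^ (4 - A : ℝ))) :
    friedlanderIwaniecSum_isEquivalent :=
  friedlanderIwaniecSum_isEquivalent_of_primeSum (FriedlanderIwaniec1998_primeSum_asymp_of_prop41pos h41)

/-- **Infinitely many primes `a² + b⁴` from Proposition 4.1 for positive `P` alone.**
[cite: FriedlanderIwaniecAnnals1998, Theorem 1] -/
theorem setOf_prime_sq_add_pow_four_infinite_of_prop41pos (h41 : (∀ η : ℝ, 0 < η → ∀ A : ℝ, 0 < A → ∃ B : ℝ, 0 < B ∧ ∃ K : ℝ, ∀ᶠ x : ℝ in atTop,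
      ∀ P : ℝ, 0 < P → Real.log (Real.log x) ^ 2 ≤ Real.log P →
        Real.log P ≤ Real.log x * (Real.log (Real.log x))⁻¹ ^ 2 →
      ∀ N : ℝ, x ^ (1 / 4 + η : ℝ) < N → N < x ^ (1 / 2 : ℝ) / Real.log x ^ B →
      ∀ C : ℝ, 1 ≤ C → C ≤ N ^ (1 - η : ℝ) →
        fiSieveSeq.fiBilinearPi x N C P ≤ K * fiCount x * Real.log x ^ (4 - A : ℝ))) :
    setOf_prime_sq_add_pow_four_infinite :=
  setOf_prime_sq_add_pow_four_infinite_of_primeSum (FriedlanderIwaniec1998_primeSum_asymp_of_prop41pos h41)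

/-- **FI (4.7)–(4.8) from the sector bound (5.15) alone** (through §5: `…_bilinBound_of_sectorBound`,
§4: `…_prop41pos_of_bilinBound`, and §§2–4 for positive `P`).
[cite: FriedlanderIwaniecAnnals1998, (4.7)-(4.8) via (5.15), (4.23), Proposition 4.1] -/
theorem FriedlanderIwaniec1998_primeSum_asymp_of_sectorBound (h : (∀ η : ℝ, 0 < η → ∀ A : ℝ, 0 < A →
      ∃ A' t B K : ℝ, 2 * A + 2 ^ 20 ≤ A' ∧ A + 124 ≤ t ∧ 0 < B ∧ 0 < K ∧
      ∀ᶠ x : ℝ in atTop,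
        ∀ P : ℝ, 0 < P → Real.log (Real.log x) ^ 2 ≤ Real.log P →
          Real.log P ≤ Real.log x * (Real.log (Real.log x))⁻¹ ^ 2 →
        ∀ N : ℝ, x ^ (1 / 4 + η : ℝ) < N → N < x ^ (1 / 2 : ℝ) / Real.log x ^ B →
        ∀ C : ℝ, 1 ≤ C → C ≤ N ^ (1 - η : ℝ) →
          Sector515At x P N C (2 * A + 8) (Real.log x ^ (-A')) (Real.log x ^ t)
            (Real.log x ^ (-A)) K)) :
    FriedlanderIwaniec1998_primeSum_asymp :=
  FriedlanderIwaniec1998_primeSum_asymp_of_prop41pos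
    (FriedlanderIwaniec1998_prop41pos_of_bilinBound (FriedlanderIwaniec1998_bilinBound_of_sectorBound h))

/-- **Friedlander–Iwaniec Theorem 1 (parity.S17: `∑∑_{a²+b⁴≤x} Λ(a²+b⁴) ∼ 4π⁻¹κx^{3/4}`) from the
sector bound (5.15) alone** — the trust base of parity.S17 is now FI's bound (5.15) for the sector
forms `B(M, N)` off the axes, proved in §§5–26 of the source.
[cite: FriedlanderIwaniecAnnals1998, Theorem 1 via (5.15)] -/
theorem friedlanderIwaniecSum_isEquivalent_of_sectorBound (h : (∀ η : ℝ, 0 < η → ∀ A : ℝ, 0 < A →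
      ∃ A' t B K : ℝ, 2 * A + 2 ^ 20 ≤ A' ∧ A + 124 ≤ t ∧ 0 < B ∧ 0 < K ∧
      ∀ᶠ x : ℝ in atTop,
        ∀ P : ℝ, 0 < P → Real.log (Real.log x) ^ 2 ≤ Real.log P →
          Real.log P ≤ Real.log x * (Real.log (Real.log x))⁻¹ ^ 2 →
        ∀ N : ℝ, x ^ (1 / 4 + η : ℝ) < N → N < x ^ (1 / 2 : ℝ) / Real.log x ^ B →
        ∀ C : ℝ, 1 ≤ C → C ≤ N ^ (1 - η : ℝ) →
          Sector515At x P N C (2 * A + 8) (Real.log x ^ (-A')) (Real.log x ^ t)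
            (Real.log x ^ (-A)) K)) :
    friedlanderIwaniecSum_isEquivalent :=
  friedlanderIwaniecSum_isEquivalent_of_prop41pos
    (FriedlanderIwaniec1998_prop41pos_of_bilinBound (FriedlanderIwaniec1998_bilinBound_of_sectorBound h))

/-- **Infinitely many primes `p = a² + b⁴` from the sector bound (5.15) alone.**
[cite: FriedlanderIwaniecAnnals1998, Theorem 1 via (5.15)] -/
theorem setOf_prime_sq_add_pow_four_infinite_of_sectorBound (h : (∀ η : ℝ, 0 < η → ∀ A : ℝ, 0 < A →
      ∃ A' t B K : ℝ, 2 * A + 2 ^ 20 ≤ A' ∧ A + 124 ≤ t ∧ 0 < B ∧ 0 < K ∧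
      ∀ᶠ x : ℝ in atTop,
        ∀ P : ℝ, 0 < P → Real.log (Real.log x) ^ 2 ≤ Real.log P →
          Real.log P ≤ Real.log x * (Real.log (Real.log x))⁻¹ ^ 2 →
        ∀ N : ℝ, x ^ (1 / 4 + η : ℝ) < N → N < x ^ (1 / 2 : ℝ) / Real.log x ^ B →
        ∀ C : ℝ, 1 ≤ C → C ≤ N ^ (1 - η : ℝ) →
          Sector515At x P N C (2 * A + 8) (Real.log x ^ (-A')) (Real.log x ^ t)
            (Real.log x ^ (-A)) K)) :
    setOf_prime_sq_add_pow_four_infinite :=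
  setOf_prime_sq_add_pow_four_infinite_of_prop41pos
    (FriedlanderIwaniec1998_prop41pos_of_bilinBound (FriedlanderIwaniec1998_bilinBound_of_sectorBound h))

end Literature.NumberTheory.Sieve
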